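import Mathlib
import Literature.Barriers.QuantumFields.MigdalKadanoffGroupBlindness
import HarnessLib

/-!
# Discharge of `MigdalKadanoffGroupBlindness`: Ito's theorem for compact QED₄ (the `D = 4` Migdal–Kadanoff recursion drives `U(1)` to strong coupling), proved

This file PROVES the named fact
`Literature.Barriers.QuantumFields.MigdalKadanoffGroupBlindness` of the barrier catalogue
(`MigdalKadanoffGroupBlindness.lean`): for every `β > 0` the standard Migdal–Kadanoff iterates
(`D = 4`, scale factor `b = 2`, Kadanoff ordering "raise the weight to the power `b^{D-2} = 4`,
then convolve `b² = 4` copies") of the normalised Fourier coefficients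
`c_j = I_j(β)/I_0(β)` of the `U(1)` Wilson plaquette weight `exp(β cos θ)` converge
coefficient-wise to the strong-coupling (high-temperature) fixed point: `c_j(n) → 0` for every
`j ≠ 0` (Ito 1985; quoted as Theorem 2.1 of Ito–Seiler 2007 and in Ito–Seiler 2009 §1, §3).
The theorem is `Literature.Barriers.QuantumFields.MigdalKadanoffGroupBlindness_holds`; no new
named fact is introduced, every auxiliary statement is proved.

## The proof (Ito's local-curvature Lyapunov argument at the critical dimension)

Ito's 1984 method (Gaussian domination in the imaginary direction, CMP 95 Lemma 1) gains a
factor `λ^{-(2-s)}` per step and gives nothing at `s = D - 2 = 2`; the critical-dimension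
argument is the one printed in CMP 110 (1987) §3 for `SO(3)`, whose §5 records that it applies,
more easily, to `SO(2) = U(1)` (the content of PRL 54 (1985) 2383, not held here). We formalise
that argument for `U(1)` directly:

* In function space the (unnormalised) recursion is `F ↦ ((F⁴ ⋆ F⁴) ⋆ F⁴) ⋆ F⁴`
  (`Ito.mkFunStep`, `Ito.mkFun β n`, `F₀ = exp(β cos θ)`), `⋆` = convolution over a period
  (`Ito.pconv`); normalisations are irrelevant for the ratios `c_j = ĉ_j/ĉ_0`.
* The Lyapunov functional is the maximal LOCAL curvature of the effective action,
  `B(F) = max_θ b_F(θ)`, `b_F = -(log F)″ = (F'² - F″F)/F²` (CMP 110 eqs. (13)–(15)); under the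
  fourth power `b ↦ 4b`, and under a periodic convolution `K = P ⋆ Q` one has, for every `α`,
  `b_K(θ) ≤ E_θ[α² b_P + (1-α)² b_Q]` for the probability density `∝ P(θ-t)Q(t) dt`
  (differentiate under the integral, move derivatives across the convolution by periodic
  integration by parts, and Cauchy–Schwarz — the `U(1)` form of CMP 110 eqs. (19)–(21)); since
  `b_P` has ZERO MEAN over a period (it is minus the derivative of the periodic function `P'/P`)
  and the density is bounded below by `ρ = (min P min Q)/(max P max Q)` times the uniform one,
  the average is at most `(1-ρ) max b_P`: `Ito.curv_pconv`. With `α = 1/2, 2/3, 3/4` along the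
  three convolutions the marginal factors `4 · (1/4)` cancel exactly (the criticality of `D = 4`)
  and the gain survives: `B_{n+1} ≤ (1 - e^{-4π²B_n}/4) B_n` (`Ito.mkFunStep_spec`, with
  `min F/max F ≥ e^{-π²B/2}` from `Ito.exists_bounds_of_curv`, CMP 110 eq. (24)). Hence
  `B_n ≤ qⁿβ → 0` (`Ito.tendsto_bseq`) — geometric, with the (physically expected) exponentially
  small rate `1 - q = e^{-4π²β}/4`.
* `B_n → 0` forces `e^{-π²B_n/2} max F_n ≤ F_n ≤ max F_n`, whence
  `|ĉ_j(n)/ĉ_0(n)| ≤ e^{π²B_n/2} - 1 → 0` for `j ≠ 0` (`Ito.abs_fc_div_le`).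
* The bridge `Ito.mkIter_u1WilsonCoeff_eq` identifies the tree's coefficient recursion
  (`MigdalKadanoff.mkIter`: `tsum`-convolutions on `ℤ`, then fourth powers) with the normalised
  Fourier cosine transform of `Ito.mkFun β n`: Fourier coefficients of a product are the
  `ℤ`-convolution of the coefficients (`Ito.hasSum_fc_mul_fc`, via pointwise Fourier inversion
  transferred from Mathlib's `has_pointwise_sum_fourier_series_of_summable` on `AddCircle (2π)`,
  `Ito.hasSum_fc_cos`, and the `C²` decay `ĉ_j = -ĉ″_j/j²`, `Ito.fc_eq_neg_fc_deriv2_div`), and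
  Fourier coefficients of a periodic convolution multiply (`Ito.fc_pconv`, Fubini).

## References

* K. R. Ito, Commun. Math. Phys. 110 (1987) 237–246 (`Ito1987HierarchicalHeisenberg`) — §3
  (eqs. (13)–(24)), §5 (the `SO(2)` remark). Read in full (Project Euclid).
* K. R. Ito, Commun. Math. Phys. 95 (1984) 247–255 (`Ito1984AnalyticMK`) — the recursion
  formulas (2), (3), the initial weight (4b); Thm 1 (`D < 4`). Read in full (Project Euclid).
* K. R. Ito, Phys. Rev. Lett. 54 (1985) 2383 (`Ito1985KTAbsence`) and 55 (1985) 558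
  (`Ito1985MKConfinement`) — the primary announcements; not held (paywalled), cited through the
  two CMP papers and `ItoSeiler2007Tomboulis` Thm 2.1.

## Design notes

* Everything lives in the sub-namespace `Literature.Barriers.QuantumFields.MigdalKadanoff.Ito`
  except the discharge theorem itself. Functions are real, `2π`-periodic on `ℝ`; integrals are
  interval integrals over `[-π, π]`; the only contact with `AddCircle` is inside
  `Ito.hasSum_fc_cos`.
* `Ito.NiceFun f f' f″` bundles periodicity, evenness, positivity and explicit first/second
  derivatives; it is propagated through fourth powers and periodic convolutions.
* What is NOT here: rates beyond the geometric bound on `B_n`, the `SU(N)` half of Ito's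
  theorem, Migdal ordering, general scale factors `λ`, string-tension consequences.
-/

noncomputable section

open Real MeasureTheory intervalIntegral Set Filter Function

open scoped Topology

namespace Literature.Barriers.QuantumFields.MigdalKadanoff.Ito

/-! ### Periodic convolution over one period -/

/-- Periodic convolution over one period `[-π, π]` (unnormalised):
`pconv P Q θ = ∫_{-π}^{π} P (θ - t) Q(t) dt`. [folklore] -/
def pconv (P Q : ℝ → ℝ) (θ : ℝ) : ℝ := ∫ t in (-π)..π, P (θ - t) * Q t

/-- `0 < 2π`. [folklore] -/
theorem two_pi_pos' : (0 : ℝ) < 2 * π := by positivity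

/-- `-π + 2π = π`. [folklore] -/
theorem neg_pi_add_two_pi : -π + 2 * π = π := by ring

/-- `pconv P Q` is `2π`-periodic when `P` is. [folklore] -/
theorem pconv_periodic {P : ℝ → ℝ} (hP : Periodic P (2 * π)) (Q : ℝ → ℝ) :
    Periodic (pconv P Q) (2 * π) := by
  intro θ
  simp only [pconv]
  refine intervalIntegral.integral_congr fun t _ => ?_
  show P (θ + 2 * π - t) * Q t = P (θ - t) * Q t
  rw [show θ + 2 * π - t = θ - t + 2 * π by ring, hP]

/-- `pconv P Q` is even when `P` and `Q` are. [folklore] -/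
theorem pconv_even {P Q : ℝ → ℝ} (hP : ∀ x, P (-x) = P x) (hQ : ∀ x, Q (-x) = Q x) (θ : ℝ) :
    pconv P Q (-θ) = pconv P Q θ := by
  simp only [pconv]
  have h := intervalIntegral.integral_comp_neg (a := -π) (b := π)
    (f := fun t => P (θ - t) * Q t)
  simp only [neg_neg] at h
  rw [← h]
  refine intervalIntegral.integral_congr fun t _ => ?_
  show P (-θ - t) * Q t = P (θ - -t) * Q (-t)
  rw [show -θ - t = -(θ - -t) by ring, hP, hQ]

/-- Continuity of `pconv P Q` for continuous `P`, `Q`. [folklore] -/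
theorem continuous_pconv {P Q : ℝ → ℝ} (hP : Continuous P) (hQ : Continuous Q) :
    Continuous (pconv P Q) := by
  unfold pconv
  exact intervalIntegral.continuous_parametric_intervalIntegral_of_continuous'
    (f := fun x t => P (x - t) * Q t)
    ((hP.comp (continuous_fst.sub continuous_snd)).mul (hQ.comp continuous_snd)) _ _

/-- Differentiation under the integral sign: `(pconv P Q)' = pconv P' Q`. [folklore] -/
theorem hasDerivAt_pconv {P P' Q : ℝ → ℝ} (hP : ∀ x, HasDerivAt P (P' x) x)
    (hP' : Continuous P') (hQ : Continuous Q) (θ : ℝ) :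
    HasDerivAt (pconv P Q) (pconv P' Q θ) θ := by
  have hPc : Continuous P := continuous_iff_continuousAt.2 fun x => (hP x).continuousAt
  obtain ⟨C, hC⟩ : ∃ C, ∀ y ∈ Icc (θ - 1 - π) (θ + 1 + π), ‖P' y‖ ≤ C :=
    isCompact_Icc.exists_bound_of_continuousOn hP'.continuousOn
  obtain ⟨D, hD⟩ : ∃ D, ∀ t ∈ Icc (-π) π, ‖Q t‖ ≤ D :=
    isCompact_Icc.exists_bound_of_continuousOn hQ.continuousOn
  have hC0 : 0 ≤ C := (norm_nonneg _).trans (hC θ ⟨by linarith [pi_pos], by linarith [pi_pos]⟩)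
  unfold pconv
  refine (intervalIntegral.hasDerivAt_integral_of_dominated_loc_of_deriv_le
    (F := fun x t => P (x - t) * Q t) (F' := fun x t => P' (x - t) * Q t)
    (x₀ := θ) (s := Metric.ball θ 1) (bound := fun _ => C * D) (a := -π) (b := π) (μ := volume)
    (Metric.ball_mem_nhds θ one_pos) ?_ ?_ ?_ ?_ ?_ ?_).2
  · exact Eventually.of_forall fun x =>
      ((hPc.comp (continuous_const.sub continuous_id)).mul hQ).aestronglyMeasurable
  · exact ((hPc.comp (continuous_const.sub continuous_id)).mul hQ).intervalIntegrable _ _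
  · exact ((hP'.comp (continuous_const.sub continuous_id)).mul hQ).aestronglyMeasurable
  · refine ae_of_all _ fun t ht x hx => ?_
    rw [uIoc_of_le (by linarith [pi_pos])] at ht
    have hx' : |x - θ| < 1 := by simpa [Real.dist_eq] using hx
    have hx1 := (abs_lt.1 hx')
    rw [norm_mul]
    refine mul_le_mul (hC _ ⟨by linarith [ht.1, ht.2], by linarith [ht.1, ht.2]⟩)
      (hD _ ⟨ht.1.le, ht.2⟩) (norm_nonneg _) hC0
  · exact intervalIntegrable_const
  · refine ae_of_all _ fun t _ x _ => ?_
    exact ((hP (x - t)).comp_sub_const x t).mul_const (Q t)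

/-- The integral over a period of the derivative of a periodic function vanishes. [folklore] -/
theorem integral_deriv_eq_zero_of_periodic {g g' : ℝ → ℝ} (hg : ∀ x, HasDerivAt g (g' x) x)
    (hg' : Continuous g') (hper : Periodic g (2 * π)) : ∫ t in (-π)..π, g' t = 0 := by
  rw [intervalIntegral.integral_eq_sub_of_hasDerivAt (fun x _ => hg x) (hg'.intervalIntegrable _ _)]
  have h := hper (-π)
  rw [neg_pi_add_two_pi] at h
  rw [h, sub_self]

/-- Moving a derivative across a periodic convolution: `pconv P' Q = pconv P Q'`. [folklore] -/
theorem pconv_deriv_swap {P P' Q Q' : ℝ → ℝ} (hP : ∀ x, HasDerivAt P (P' x) x)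
    (hP' : Continuous P') (hPp : Periodic P (2 * π)) (hQ : ∀ x, HasDerivAt Q (Q' x) x)
    (hQ' : Continuous Q') (hQp : Periodic Q (2 * π)) (θ : ℝ) :
    pconv P' Q θ = pconv P Q' θ := by
  have hPc : Continuous P := continuous_iff_continuousAt.2 fun x => (hP x).continuousAt
  have hQc : Continuous Q := continuous_iff_continuousAt.2 fun x => (hQ x).continuousAt
  have hder : ∀ t, HasDerivAt (fun t => P (θ - t) * Q t)
      (-P' (θ - t) * Q t + P (θ - t) * Q' t) t := fun t =>
    ((hP (θ - t)).comp_const_sub θ t).fun_mul (hQ t)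
  have hperg : Periodic (fun t => P (θ - t) * Q t) (2 * π) := fun t => by
    show P (θ - (t + 2 * π)) * Q (t + 2 * π) = P (θ - t) * Q t
    rw [show θ - (t + 2 * π) = θ - t - 2 * π by ring, hPp.sub_eq, hQp]
  have hc1 : Continuous fun t => -P' (θ - t) * Q t := by fun_prop
  have hc2 : Continuous fun t => P (θ - t) * Q' t := by fun_prop
  have h0 := integral_deriv_eq_zero_of_periodic hder (hc1.add hc2) hperg
  rw [intervalIntegral.integral_add (hc1.intervalIntegrable _ _) (hc2.intervalIntegrable _ _)] at h0
  have h1 : ∫ t in (-π)..π, -P' (θ - t) * Q t = -pconv P' Q θ := by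
    simp only [pconv, ← intervalIntegral.integral_neg, neg_mul]
  rw [h1] at h0
  simp only [pconv] at h0 ⊢
  linarith

/-- Bounds on a periodic convolution from bounds on the factors. [folklore] -/
theorem pconv_le {P Q : ℝ → ℝ} (hP : Continuous P) (hQ : Continuous Q) {MP MQ : ℝ}
    (hMP : ∀ x, P x ≤ MP) (hMQ : ∀ x, Q x ≤ MQ) (hP0 : ∀ x, 0 ≤ P x) (hQ0 : ∀ x, 0 ≤ Q x)
    (θ : ℝ) : pconv P Q θ ≤ 2 * π * (MP * MQ) := by
  have h : ∫ t in (-π)..π, P (θ - t) * Q t ≤ ∫ _ in (-π)..π, MP * MQ := by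
    refine intervalIntegral.integral_mono_on (by linarith [pi_pos])
      (((hP.comp (continuous_const.sub continuous_id)).mul hQ).intervalIntegrable _ _)
      intervalIntegrable_const fun t _ => ?_
    exact mul_le_mul (hMP (θ - t)) (hMQ t) (hQ0 t) ((hP0 (θ - t)).trans (hMP (θ - t)))
  rw [intervalIntegral.integral_const, smul_eq_mul] at h
  simp only [pconv]
  linarith

/-- Bounds on a periodic convolution from bounds on the factors. [folklore] -/
theorem le_pconv {P Q : ℝ → ℝ} (hP : Continuous P) (hQ : Continuous Q) {mP mQ : ℝ}
    (hmP : ∀ x, mP ≤ P x) (hmQ : ∀ x, mQ ≤ Q x) (hmP0 : 0 ≤ mP) (hmQ0 : 0 ≤ mQ)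
    (θ : ℝ) : 2 * π * (mP * mQ) ≤ pconv P Q θ := by
  have h : ∫ _ in (-π)..π, mP * mQ ≤ ∫ t in (-π)..π, P (θ - t) * Q t := by
    refine intervalIntegral.integral_mono_on (by linarith [pi_pos])
      intervalIntegrable_const
      (((hP.comp (continuous_const.sub continuous_id)).mul hQ).intervalIntegrable _ _)
      fun t _ => ?_
    exact mul_le_mul (hmP (θ - t)) (hmQ t) hmQ0 (hmP0.trans (hmP (θ - t)))
  rw [intervalIntegral.integral_const, smul_eq_mul] at h
  simp only [pconv]
  linarith

/-! ### The regularity package -/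

/-- A `2π`-periodic, even, positive `C²` weight with explicit first and second derivatives.
[folklore] -/
structure NiceFun (f f' f'' : ℝ → ℝ) : Prop where
  periodic : Periodic f (2 * π)
  even : ∀ x, f (-x) = f x
  pos : ∀ x, 0 < f x
  hasDerivAt : ∀ x, HasDerivAt f (f' x) x
  hasDerivAt' : ∀ x, HasDerivAt f' (f'' x) x
  continuous'' : Continuous f''

namespace NiceFun

variable {f f' f'' : ℝ → ℝ}

/-- A nice weight is continuous. [folklore] -/
theorem continuous (h : NiceFun f f' f'') : Continuous f :=
  continuous_iff_continuousAt.2 fun x => (h.hasDerivAt x).continuousAt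

/-- The derivative of a nice weight is continuous. [folklore] -/
theorem continuous' (h : NiceFun f f' f'') : Continuous f' :=
  continuous_iff_continuousAt.2 fun x => (h.hasDerivAt' x).continuousAt

/-- The derivative of a nice weight is `2π`-periodic. [folklore] -/
theorem periodic' (h : NiceFun f f' f'') : Periodic f' (2 * π) := by
  intro x
  have h1 : HasDerivAt (fun y => f (y + 2 * π)) (f' (x + 2 * π)) x :=
    (h.hasDerivAt (x + 2 * π)).comp_add_const x (2 * π)
  have h2 : (fun y => f (y + 2 * π)) = f := funext fun y => h.periodic y
  rw [h2] at h1
  exact h1.unique (h.hasDerivAt x)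

/-- The second derivative of a nice weight is `2π`-periodic. [folklore] -/
theorem periodic'' (h : NiceFun f f' f'') : Periodic f'' (2 * π) := by
  intro x
  have h1 : HasDerivAt (fun y => f' (y + 2 * π)) (f'' (x + 2 * π)) x :=
    (h.hasDerivAt' (x + 2 * π)).comp_add_const x (2 * π)
  have h2 : (fun y => f' (y + 2 * π)) = f' := funext fun y => h.periodic' y
  rw [h2] at h1
  exact h1.unique (h.hasDerivAt' x)

/-- A nice weight never vanishes. [folklore] -/
theorem ne_zero (h : NiceFun f f' f'') (x : ℝ) : f x ≠ 0 := (h.pos x).ne'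

/-- The fourth power of a nice weight is nice. [folklore] -/
theorem pow4 (h : NiceFun f f' f'') :
    NiceFun (fun x => f x ^ 4) (fun x => 4 * f x ^ 3 * f' x)
      (fun x => 12 * f x ^ 2 * f' x ^ 2 + 4 * f x ^ 3 * f'' x) where
  periodic x := by simp only [h.periodic x]
  even x := by simp only [h.even x]
  pos x := pow_pos (h.pos x) 4
  hasDerivAt x := by
    have := (h.hasDerivAt x).fun_pow 4
    simpa using this
  hasDerivAt' x := by
    have h1 : HasDerivAt (fun x => f x ^ 3) (3 * f x ^ 2 * f' x) x := by
      simpa using (h.hasDerivAt x).fun_pow 3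
    have h2 := ((h1.const_mul 4).fun_mul (h.hasDerivAt' x))
    refine h2.congr_deriv ?_
    ring
  continuous'' := by
    have hc := h.continuous
    have hc' := h.continuous'
    have hc'' := h.continuous''
    fun_prop

/-- The periodic convolution of nice weights is nice, with derivatives `pconv P' Q`, `pconv P'' Q`.
[folklore] -/
theorem pconv {P P' P'' Q Q' Q'' : ℝ → ℝ} (hP : NiceFun P P' P'') (hQ : NiceFun Q Q' Q'') :
    NiceFun (pconv P Q) (pconv P' Q) (pconv P'' Q) where
  periodic := pconv_periodic hP.periodic Q
  even := pconv_even hP.even hQ.even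
  pos θ := by
    obtain ⟨mP, hmP⟩ : ∃ m, 0 < m ∧ ∀ x, m ≤ P x := by
      obtain ⟨x₀, _, hx₀⟩ := (isCompact_Icc (a := -π) (b := π)).exists_isMinOn
        (nonempty_Icc.2 (by linarith [pi_pos])) hP.continuous.continuousOn
      refine ⟨P x₀, hP.pos x₀, fun x => ?_⟩
      obtain ⟨y, hy, hxy⟩ := hP.periodic.exists_mem_Ico two_pi_pos' x (-π)
      rw [hxy]
      exact hx₀ ⟨hy.1, by linarith [hy.2]⟩
    obtain ⟨mQ, hmQ⟩ : ∃ m, 0 < m ∧ ∀ x, m ≤ Q x := by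
      obtain ⟨x₀, _, hx₀⟩ := (isCompact_Icc (a := -π) (b := π)).exists_isMinOn
        (nonempty_Icc.2 (by linarith [pi_pos])) hQ.continuous.continuousOn
      refine ⟨Q x₀, hQ.pos x₀, fun x => ?_⟩
      obtain ⟨y, hy, hxy⟩ := hQ.periodic.exists_mem_Ico two_pi_pos' x (-π)
      rw [hxy]
      exact hx₀ ⟨hy.1, by linarith [hy.2]⟩
    have := le_pconv hP.continuous hQ.continuous hmP.2 hmQ.2 hmP.1.le hmQ.1.le θ
    have h2 : 0 < 2 * π * (mP * mQ) := by
      have := mul_pos hmP.1 hmQ.1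
      positivity
    linarith
  hasDerivAt := hasDerivAt_pconv hP.hasDerivAt hP.continuous' hQ.continuous
  hasDerivAt' := hasDerivAt_pconv hP.hasDerivAt' hP.continuous'' hQ.continuous
  continuous'' := continuous_pconv hP.continuous'' hQ.continuous

end NiceFun

/-! ### Ito's local-curvature step -/

/-- Weighted Cauchy–Schwarz for interval integrals: `(∫ φ w)² ≤ (∫ w)(∫ φ² w)` for `w ≥ 0`.
[folklore] -/
theorem sq_integral_mul_le {φ w : ℝ → ℝ} (hφ : Continuous φ) (hw : Continuous w)
    (hw0 : ∀ t, 0 ≤ w t) :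
    (∫ t in (-π)..π, φ t * w t) ^ 2 ≤
      (∫ t in (-π)..π, w t) * ∫ t in (-π)..π, φ t ^ 2 * w t := by
  have hquad : ∀ x : ℝ, 0 ≤ (∫ t in (-π)..π, w t) * (x * x) +
      (-2 * ∫ t in (-π)..π, φ t * w t) * x + ∫ t in (-π)..π, φ t ^ 2 * w t := by
    intro x
    have h0 : 0 ≤ ∫ t in (-π)..π, (x - φ t) ^ 2 * w t :=
      intervalIntegral.integral_nonneg (by linarith [pi_pos]) fun t _ =>
        mul_nonneg (sq_nonneg _) (hw0 t)
    have h1 : ∫ t in (-π)..π, (x - φ t) ^ 2 * w t =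
        (∫ t in (-π)..π, w t) * (x * x) + (-2 * ∫ t in (-π)..π, φ t * w t) * x +
          ∫ t in (-π)..π, φ t ^ 2 * w t := by
      have e : ∀ t, (x - φ t) ^ 2 * w t =
          (x * x) * w t + (-2 * x) * (φ t * w t) + φ t ^ 2 * w t := fun t => by ring
      simp_rw [e]
      rw [intervalIntegral.integral_add, intervalIntegral.integral_add,
        intervalIntegral.integral_const_mul, intervalIntegral.integral_const_mul]
      · ring
      all_goals apply Continuous.intervalIntegrable; fun_prop
    linarith
  have hd := discrim_le_zero hquad
  rw [discrim] at hd
  nlinarith [hd]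

/-- The local curvature `(P'² - P″P)/P²` of a positive periodic `C²` function has zero mean over a
period (it is minus the derivative of the periodic function `P'/P`), here composed with a
reflection–translation. [folklore] -/
theorem integral_curv_comp_sub_eq_zero {P P' P'' : ℝ → ℝ} (hP : NiceFun P P' P'') (θ : ℝ) :
    ∫ t in (-π)..π, (P' (θ - t) ^ 2 - P'' (θ - t) * P (θ - t)) / P (θ - t) ^ 2 = 0 := by
  have hg : ∀ x, HasDerivAt (fun x => P' x / P x)
      ((P'' x * P x - P' x * P' x) / P x ^ 2) x := fun x =>
    (hP.hasDerivAt' x).fun_div (hP.hasDerivAt x) (hP.ne_zero x)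
  have hh : ∀ t, HasDerivAt (fun t => P' (θ - t) / P (θ - t))
      ((P' (θ - t) ^ 2 - P'' (θ - t) * P (θ - t)) / P (θ - t) ^ 2) t := fun t => by
    have := (hg (θ - t)).comp_const_sub θ t
    refine this.congr_deriv ?_
    rw [neg_div', neg_sub]
    ring
  have hPne := hP.ne_zero
  have cP := hP.continuous
  have cP' := hP.continuous'
  have cP'' := hP.continuous''
  refine integral_deriv_eq_zero_of_periodic hh ?_ ?_
  · exact Continuous.div (by fun_prop) (by fun_prop) fun t => pow_ne_zero 2 (hPne _)
  · intro t
    show P' (θ - (t + 2 * π)) / P (θ - (t + 2 * π)) = P' (θ - t) / P (θ - t)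
    rw [show θ - (t + 2 * π) = θ - t - 2 * π by ring, hP.periodic.sub_eq, hP.periodic'.sub_eq]

/-- **Ito's local-curvature step** (the heart of the proof that the `D = 4` Migdal–Kadanoff
recursion drives `U(1)` to high temperature): if `b_P = (P'² - P″P)/P² ≤ B_P` (with `B_P ≥ 0`)
and `b_Q ≤ B_Q`, and `m_P ≤ P ≤ M_P`, `m_Q ≤ Q ≤ M_Q` with `m_P, m_Q > 0`, then for every
`α` the periodic convolution `K = P ⋆ Q` satisfies
`b_K ≤ α² (1 - ρ) B_P + (1 - α)² B_Q`, `ρ = m_P m_Q/(M_P M_Q)`.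
The gain `(1 - ρ)` comes from the zero mean of `b_P` over a period. Adapted from Ito's argument
for `SO(3)` (eqs. (19)–(21)) to `U(1)`. [cite: Ito1987HierarchicalHeisenberg, §3 eqs. (19)–(21)] -/
theorem curv_pconv {P P' P'' Q Q' Q'' : ℝ → ℝ} (hP : NiceFun P P' P'') (hQ : NiceFun Q Q' Q'')
    {BP BQ mP MP mQ MQ : ℝ} (hBP : 0 ≤ BP)
    (hcP : ∀ x, P' x ^ 2 - P'' x * P x ≤ BP * P x ^ 2)
    (hcQ : ∀ x, Q' x ^ 2 - Q'' x * Q x ≤ BQ * Q x ^ 2)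
    (hmP : ∀ x, mP ≤ P x) (hMP : ∀ x, P x ≤ MP) (hmQ : ∀ x, mQ ≤ Q x) (hMQ : ∀ x, Q x ≤ MQ)
    (hmP0 : 0 < mP) (hmQ0 : 0 < mQ) (α θ : ℝ) :
    pconv P' Q θ ^ 2 - pconv P'' Q θ * pconv P Q θ ≤
      (α ^ 2 * (1 - mP * mQ / (MP * MQ)) * BP + (1 - α) ^ 2 * BQ) * pconv P Q θ ^ 2 := by
  have hPne := hP.ne_zero
  have hQne := hQ.ne_zero
  have cP := hP.continuous
  have cP' := hP.continuous'
  have cP'' := hP.continuous''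
  have cQ := hQ.continuous
  have cQ' := hQ.continuous'
  have cQ'' := hQ.continuous''
  have hMP0 : 0 < MP := hmP0.trans_le ((hmP 0).trans (hMP 0))
  have hMQ0 : 0 < MQ := hmQ0.trans_le ((hmQ 0).trans (hMQ 0))
  -- the three integration-by-parts identities
  have I1 : pconv P' Q θ = pconv P Q' θ :=
    pconv_deriv_swap hP.hasDerivAt cP' hP.periodic hQ.hasDerivAt cQ' hQ.periodic θ
  have I2 : pconv P'' Q θ = pconv P' Q' θ :=
    pconv_deriv_swap hP.hasDerivAt' cP'' hP.periodic' hQ.hasDerivAt cQ' hQ.periodic θ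
  have I3 : pconv P' Q' θ = pconv P Q'' θ :=
    pconv_deriv_swap hP.hasDerivAt cP' hP.periodic hQ.hasDerivAt' cQ'' hQ.periodic' θ
  -- bounds on K
  have hKle : pconv P Q θ ≤ 2 * π * (MP * MQ) :=
    pconv_le cP cQ hMP hMQ (fun x => hmP0.le.trans (hmP x)) (fun x => hmQ0.le.trans (hmQ x)) θ
  have hKge : 2 * π * (mP * mQ) ≤ pconv P Q θ := le_pconv cP cQ hmP hmQ hmP0.le hmQ0.le θ
  have hKpos : 0 < pconv P Q θ := lt_of_lt_of_le (by positivity) hKge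
  -- the weight and the test function
  set w : ℝ → ℝ := fun t => P (θ - t) * Q t with hw
  have hw0 : ∀ t, 0 ≤ w t := fun t => (mul_pos (hP.pos _) (hQ.pos _)).le
  have cw : Continuous w := by rw [hw]; fun_prop
  have hKw : pconv P Q θ = ∫ t in (-π)..π, w t := rfl
  set φ : ℝ → ℝ := fun t => α * (P' (θ - t) / P (θ - t)) + (1 - α) * (Q' t / Q t) with hφ
  have cφ : Continuous φ := by
    rw [hφ]
    refine (continuous_const.mul (Continuous.div (by fun_prop) (by fun_prop) fun t => hPne _)).add
      (continuous_const.mul (Continuous.div cQ' cQ fun t => hQne _))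
  -- ∫ φ w = K'
  have Hφ : ∫ t in (-π)..π, φ t * w t = pconv P' Q θ := by
    have e : ∀ t, φ t * w t = α * (P' (θ - t) * Q t) + (1 - α) * (P (θ - t) * Q' t) := by
      intro t
      have h1 := hPne (θ - t)
      have h2 := hQne t
      simp only [hφ, hw]
      field_simp
    simp_rw [e]
    rw [intervalIntegral.integral_add, intervalIntegral.integral_const_mul,
      intervalIntegral.integral_const_mul]
    · change α * pconv P' Q θ + (1 - α) * pconv P Q' θ = pconv P' Q θ
      rw [← I1]; ring
    all_goals apply Continuous.intervalIntegrable; fun_prop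
  -- ∫ φ² w
  have Hφ2 : ∫ t in (-π)..π, φ t ^ 2 * w t =
      α ^ 2 * (∫ t in (-π)..π, P' (θ - t) ^ 2 / P (θ - t) * Q t) +
        2 * α * (1 - α) * pconv P' Q' θ +
        (1 - α) ^ 2 * ∫ t in (-π)..π, P (θ - t) * (Q' t ^ 2 / Q t) := by
    have e : ∀ t, φ t ^ 2 * w t = α ^ 2 * (P' (θ - t) ^ 2 / P (θ - t) * Q t) +
        2 * α * (1 - α) * (P' (θ - t) * Q' t) + (1 - α) ^ 2 * (P (θ - t) * (Q' t ^ 2 / Q t)) := by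
      intro t
      have h1 := hPne (θ - t)
      have h2 := hQne t
      simp only [hφ, hw]
      field_simp
      ring
    simp_rw [e]
    rw [intervalIntegral.integral_add, intervalIntegral.integral_add,
      intervalIntegral.integral_const_mul, intervalIntegral.integral_const_mul,
      intervalIntegral.integral_const_mul]
    · rfl
    all_goals apply Continuous.intervalIntegrable
    all_goals
      first
      | exact ((Continuous.div (by fun_prop) (by fun_prop) fun t => hPne _).mul cQ).const_mul _
      | exact (((cP.comp (continuous_const.sub continuous_id)).mul
          (Continuous.div (by fun_prop) cQ fun t => hQne _)).const_mul _)
      | fun_prop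
      | exact (((Continuous.div (by fun_prop) (by fun_prop) fun t => hPne _).mul cQ).const_mul
          _).add (by fun_prop)
  -- Cauchy–Schwarz
  have CS := sq_integral_mul_le cφ cw hw0
  rw [Hφ, ← hKw] at CS
  -- the P-term: zero mean of the curvature gives the gain
  have TA : (∫ t in (-π)..π, P' (θ - t) ^ 2 / P (θ - t) * Q t) - pconv P'' Q θ ≤
      BP * (pconv P Q θ - 2 * π * (mP * mQ)) := by
    have e1 : (∫ t in (-π)..π, P' (θ - t) ^ 2 / P (θ - t) * Q t) - pconv P'' Q θ =
        ∫ t in (-π)..π, (P' (θ - t) ^ 2 - P'' (θ - t) * P (θ - t)) / P (θ - t) ^ 2 * w t := by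
      rw [pconv, ← intervalIntegral.integral_sub]
      · refine intervalIntegral.integral_congr fun t _ => ?_
        have h1 := hPne (θ - t)
        simp only [hw]
        field_simp
      · exact ((Continuous.div (by fun_prop) (by fun_prop) fun t => hPne _).mul
          cQ).intervalIntegrable _ _
      · exact Continuous.intervalIntegrable (by fun_prop) _ _
    have ccurv : Continuous fun t => (P' (θ - t) ^ 2 - P'' (θ - t) * P (θ - t)) / P (θ - t) ^ 2 :=
      Continuous.div (by fun_prop) (by fun_prop) fun t => pow_ne_zero 2 (hPne _)
    have e2 : (∫ t in (-π)..π, (P' (θ - t) ^ 2 - P'' (θ - t) * P (θ - t)) / P (θ - t) ^ 2 * w t) =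
        (∫ t in (-π)..π, (P' (θ - t) ^ 2 - P'' (θ - t) * P (θ - t)) / P (θ - t) ^ 2 *
            (w t - mP * mQ)) +
          (mP * mQ) * ∫ t in (-π)..π,
            (P' (θ - t) ^ 2 - P'' (θ - t) * P (θ - t)) / P (θ - t) ^ 2 := by
      rw [← intervalIntegral.integral_const_mul, ← intervalIntegral.integral_add]
      · refine intervalIntegral.integral_congr fun t _ => ?_
        ring
      · exact (ccurv.mul (cw.sub continuous_const)).intervalIntegrable _ _
      · exact (continuous_const.mul ccurv).intervalIntegrable _ _
    rw [e1, e2, integral_curv_comp_sub_eq_zero hP θ, mul_zero, add_zero]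
    have hle : ∀ t, (P' (θ - t) ^ 2 - P'' (θ - t) * P (θ - t)) / P (θ - t) ^ 2 * (w t - mP * mQ) ≤
        BP * (w t - mP * mQ) := by
      intro t
      have hwm : 0 ≤ w t - mP * mQ := by
        have := mul_le_mul (hmP (θ - t)) (hmQ t) hmQ0.le (hmP0.le.trans (hmP _))
        simp only [hw]; linarith
      refine mul_le_mul_of_nonneg_right ?_ hwm
      rw [div_le_iff₀ (pow_pos (hP.pos _) 2)]
      exact hcP _
    calc (∫ t in (-π)..π, (P' (θ - t) ^ 2 - P'' (θ - t) * P (θ - t)) / P (θ - t) ^ 2 *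
            (w t - mP * mQ))
        ≤ ∫ t in (-π)..π, BP * (w t - mP * mQ) :=
          intervalIntegral.integral_mono_on (by linarith [pi_pos])
            ((ccurv.mul (cw.sub continuous_const)).intervalIntegrable _ _)
            ((continuous_const.mul (cw.sub continuous_const)).intervalIntegrable _ _)
            fun t _ => hle t
      _ = BP * (pconv P Q θ - 2 * π * (mP * mQ)) := by
          rw [intervalIntegral.integral_const_mul, intervalIntegral.integral_sub
            (cw.intervalIntegrable _ _) intervalIntegrable_const, intervalIntegral.integral_const,
            smul_eq_mul, ← hKw]
          ring
  -- the Q-term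
  have TC : (∫ t in (-π)..π, P (θ - t) * (Q' t ^ 2 / Q t)) - pconv P Q'' θ ≤ BQ * pconv P Q θ := by
    have e1 : (∫ t in (-π)..π, P (θ - t) * (Q' t ^ 2 / Q t)) - pconv P Q'' θ =
        ∫ t in (-π)..π, (Q' t ^ 2 - Q'' t * Q t) / Q t ^ 2 * w t := by
      rw [pconv, ← intervalIntegral.integral_sub]
      · refine intervalIntegral.integral_congr fun t _ => ?_
        have h2 := hQne t
        simp only [hw]
        field_simp
      · exact ((cP.comp (continuous_const.sub continuous_id)).mul
          (Continuous.div (by fun_prop) cQ fun t => hQne _)).intervalIntegrable _ _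
      · exact Continuous.intervalIntegrable (by fun_prop) _ _
    rw [e1, hKw, ← intervalIntegral.integral_const_mul]
    have ccurv : Continuous fun t => (Q' t ^ 2 - Q'' t * Q t) / Q t ^ 2 :=
      Continuous.div (by fun_prop) (by fun_prop) fun t => pow_ne_zero 2 (hQne _)
    refine intervalIntegral.integral_mono_on (by linarith [pi_pos])
      ((ccurv.mul cw).intervalIntegrable _ _) ((continuous_const.mul cw).intervalIntegrable _ _)
      fun t _ => ?_
    refine mul_le_mul_of_nonneg_right ?_ (hw0 t)
    rw [div_le_iff₀ (pow_pos (hQ.pos _) 2)]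
    exact hcQ _
  -- assemble
  have hK2 : pconv P'' Q θ = α ^ 2 * pconv P'' Q θ + 2 * α * (1 - α) * pconv P' Q' θ +
      (1 - α) ^ 2 * pconv P Q'' θ := by
    rw [← I3, ← I2]; ring
  have hρ : mP * mQ / (MP * MQ) * pconv P Q θ ≤ 2 * π * (mP * mQ) := by
    rw [div_mul_eq_mul_div, div_le_iff₀ (mul_pos hMP0 hMQ0)]
    calc mP * mQ * pconv P Q θ ≤ mP * mQ * (2 * π * (MP * MQ)) :=
          mul_le_mul_of_nonneg_left hKle (mul_pos hmP0 hmQ0).le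
      _ = 2 * π * (mP * mQ) * (MP * MQ) := by ring
  have hmain : pconv P' Q θ ^ 2 - pconv P'' Q θ * pconv P Q θ ≤
      pconv P Q θ * (α ^ 2 * (BP * (pconv P Q θ - 2 * π * (mP * mQ))) +
        (1 - α) ^ 2 * (BQ * pconv P Q θ)) := by
    have h1 : pconv P' Q θ ^ 2 - pconv P'' Q θ * pconv P Q θ ≤
        pconv P Q θ * ((∫ t in (-π)..π, φ t ^ 2 * w t) - pconv P'' Q θ) := by nlinarith
    have h2 : (∫ t in (-π)..π, φ t ^ 2 * w t) - pconv P'' Q θ =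
        α ^ 2 * ((∫ t in (-π)..π, P' (θ - t) ^ 2 / P (θ - t) * Q t) - pconv P'' Q θ) +
          (1 - α) ^ 2 * ((∫ t in (-π)..π, P (θ - t) * (Q' t ^ 2 / Q t)) - pconv P Q'' θ) := by
      rw [Hφ2]
      nth_rewrite 1 [hK2]
      ring
    rw [h2] at h1
    refine h1.trans (mul_le_mul_of_nonneg_left ?_ hKpos.le)
    gcongr
  refine hmain.trans ?_
  have h3 : α ^ 2 * (BP * (pconv P Q θ - 2 * π * (mP * mQ))) ≤
      α ^ 2 * (BP * ((1 - mP * mQ / (MP * MQ)) * pconv P Q θ)) := by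
    gcongr
    linarith
  nlinarith [h3, hKpos]

/-- The curvature step without the gain: `b_K ≤ α² B_P + (1 - α)² B_Q`. [folklore] -/
theorem curv_pconv' {P P' P'' Q Q' Q'' : ℝ → ℝ} (hP : NiceFun P P' P'') (hQ : NiceFun Q Q' Q'')
    {BP BQ mP MP mQ MQ : ℝ} (hBP : 0 ≤ BP)
    (hcP : ∀ x, P' x ^ 2 - P'' x * P x ≤ BP * P x ^ 2)
    (hcQ : ∀ x, Q' x ^ 2 - Q'' x * Q x ≤ BQ * Q x ^ 2)
    (hmP : ∀ x, mP ≤ P x) (hMP : ∀ x, P x ≤ MP) (hmQ : ∀ x, mQ ≤ Q x) (hMQ : ∀ x, Q x ≤ MQ)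
    (hmP0 : 0 < mP) (hmQ0 : 0 < mQ) (α θ : ℝ) :
    pconv P' Q θ ^ 2 - pconv P'' Q θ * pconv P Q θ ≤
      (α ^ 2 * BP + (1 - α) ^ 2 * BQ) * pconv P Q θ ^ 2 := by
  refine (curv_pconv hP hQ hBP hcP hcQ hmP hMP hmQ hMQ hmP0 hmQ0 α θ).trans ?_
  have hMP0 : 0 < MP := hmP0.trans_le ((hmP 0).trans (hMP 0))
  have hMQ0 : 0 < MQ := hmQ0.trans_le ((hmQ 0).trans (hMQ 0))
  have hρ : 0 ≤ mP * mQ / (MP * MQ) := by positivity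
  have h1 : α ^ 2 * (1 - mP * mQ / (MP * MQ)) * BP ≤ α ^ 2 * BP := by
    have : α ^ 2 * (1 - mP * mQ / (MP * MQ)) * BP =
        α ^ 2 * BP - α ^ 2 * BP * (mP * mQ / (MP * MQ)) := by
      ring
    rw [this]
    nlinarith [sq_nonneg α, mul_nonneg (mul_nonneg (sq_nonneg α) hBP) hρ]
  gcongr

/-- **From a curvature bound to a two-sided bound**: if `b_F ≤ B` (`B ≥ 0`) then
`max F · e^{-Bπ²/2} ≤ F ≤ max F` (Taylor expansion of `log F` at a maximiser, where `F' = 0`,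
plus periodicity to bring every point within distance `π` of the maximiser).
[cite: Ito1987HierarchicalHeisenberg, §3 eq. (24) and Prop. 2 (9)] -/
theorem exists_bounds_of_curv {F F' F'' : ℝ → ℝ} (h : NiceFun F F' F'') {B : ℝ} (hB : 0 ≤ B)
    (hc : ∀ x, F' x ^ 2 - F'' x * F x ≤ B * F x ^ 2) :
    ∃ M, 0 < M ∧ (∀ x, F x ≤ M) ∧ ∀ x, M * Real.exp (-(B * π ^ 2 / 2)) ≤ F x := by
  obtain ⟨θ₀, -, hmax⟩ := (isCompact_Icc (a := -π) (b := π)).exists_isMaxOn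
    (nonempty_Icc.2 (by linarith [pi_pos])) h.continuous.continuousOn
  have hglob : ∀ x, F x ≤ F θ₀ := fun x => by
    obtain ⟨y, hy, hxy⟩ := h.periodic.exists_mem_Ico two_pi_pos' x (-π)
    rw [hxy]
    exact hmax ⟨hy.1, by linarith [hy.2]⟩
  refine ⟨F θ₀, h.pos θ₀, hglob, fun x => ?_⟩
  have hF'0 : F' θ₀ = 0 := by
    have hlm : IsLocalMax F θ₀ := Filter.Eventually.of_forall hglob
    exact hlm.hasDerivAt_eq_zero (h.hasDerivAt θ₀)
  -- the auxiliary function `u(x) = log F x - log F θ₀ + B (x - θ₀)² / 2` and its derivative `k`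
  set k : ℝ → ℝ := fun x => F' x / F x + B * (x - θ₀) with hk
  set u : ℝ → ℝ := fun x => Real.log (F x) - Real.log (F θ₀) + B * (x - θ₀) ^ 2 / 2 with hu
  have hku : ∀ x, HasDerivAt u (k x) x := by
    intro x
    have h1 : HasDerivAt (fun x => Real.log (F x)) (F' x / F x) x :=
      (h.hasDerivAt x).log (h.ne_zero x)
    have h2 : HasDerivAt (fun x => B * (x - θ₀) ^ 2 / 2) (B * (x - θ₀)) x := by
      have := (((hasDerivAt_id x).sub_const θ₀).fun_pow 2).const_mul B |>.div_const 2
      refine this.congr_deriv ?_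
      simp only [id]
      ring
    show HasDerivAt (fun x => Real.log (F x) - Real.log (F θ₀) + B * (x - θ₀) ^ 2 / 2)
      (F' x / F x + B * (x - θ₀)) x
    exact (h1.sub_const (Real.log (F θ₀))).fun_add h2
  have hkd : ∀ x, HasDerivAt k ((F'' x * F x - F' x * F' x) / F x ^ 2 + B) x := by
    intro x
    have h1 := (h.hasDerivAt' x).fun_div (h.hasDerivAt x) (h.ne_zero x)
    have h2 : HasDerivAt (fun x => B * (x - θ₀)) B x := by
      simpa using ((hasDerivAt_id x).sub_const θ₀).const_mul B
    show HasDerivAt (fun x => F' x / F x + B * (x - θ₀))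
      ((F'' x * F x - F' x * F' x) / F x ^ 2 + B) x
    exact h1.fun_add h2
  have hk_nonneg_deriv : ∀ x, 0 ≤ (F'' x * F x - F' x * F' x) / F x ^ 2 + B := by
    intro x
    have hFx := h.pos x
    have h1 : -B ≤ (F'' x * F x - F' x * F' x) / F x ^ 2 := by
      rw [le_div_iff₀ (pow_pos hFx 2)]
      nlinarith [hc x]
    linarith
  have hk_mono : Monotone k := by
    refine monotone_of_deriv_nonneg (fun x => (hkd x).differentiableAt) fun x => ?_
    rw [(hkd x).deriv]
    exact hk_nonneg_deriv x
  have hk0 : k θ₀ = 0 := by simp [hk, hF'0]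
  have hu0 : u θ₀ = 0 := by simp [hu]
  have hucont : Continuous u := continuous_iff_continuousAt.2 fun x => (hku x).continuousAt
  -- `u ≥ 0` everywhere (mean value theorem on each side of `θ₀`)
  have hu_nonneg : ∀ y, 0 ≤ u y := by
    intro y
    rcases lt_trichotomy θ₀ y with hy | rfl | hy
    · obtain ⟨c, hc, hceq⟩ := exists_hasDerivAt_eq_slope u k hy hucont.continuousOn
        (fun x _ => hku x)
      have hkc : 0 ≤ k c := by rw [← hk0]; exact hk_mono hc.1.le
      rw [hu0, sub_zero, eq_div_iff (by linarith)] at hceq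
      nlinarith [hceq, hc.1, hc.2]
    · exact hu0.ge
    · obtain ⟨c, hc, hceq⟩ := exists_hasDerivAt_eq_slope u k hy hucont.continuousOn
        (fun x _ => hku x)
      have hkc : k c ≤ 0 := by rw [← hk0]; exact hk_mono hc.2.le
      rw [hu0, zero_sub, eq_div_iff (by linarith)] at hceq
      nlinarith [hceq, hc.1, hc.2]
  -- bring `x` within distance `π` of `θ₀`
  obtain ⟨y, hy, hxy⟩ := h.periodic.exists_mem_Ico two_pi_pos' x (θ₀ - π)
  rw [hxy]
  have hyθ : (y - θ₀) ^ 2 ≤ π ^ 2 := by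
    have h1 : -π ≤ y - θ₀ := by linarith [hy.1]
    have h2 : y - θ₀ ≤ π := by linarith [hy.2]
    nlinarith [abs_le.2 ⟨h1, h2⟩, sq_abs (y - θ₀), pi_pos]
  have huy := hu_nonneg y
  simp only [hu] at huy
  have hlog : Real.log (F θ₀) + -(B * π ^ 2 / 2) ≤ Real.log (F y) := by
    nlinarith [mul_le_mul_of_nonneg_left hyθ hB]
  calc F θ₀ * Real.exp (-(B * π ^ 2 / 2))
      = Real.exp (Real.log (F θ₀) + -(B * π ^ 2 / 2)) := by
        rw [Real.exp_add, Real.exp_log (h.pos θ₀)]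
    _ ≤ Real.exp (Real.log (F y)) := Real.exp_le_exp.2 hlog
    _ = F y := Real.exp_log (h.pos y)

/-! ### The Migdal–Kadanoff recursion in function space -/

/-- One Migdal–Kadanoff step (`D = 4`, `b = 2`, `U(1)`, Kadanoff ordering) on plaquette weights:
`F ↦ ((F⁴ ⋆ F⁴) ⋆ F⁴) ⋆ F⁴` (raise to the power `b^{D-2} = 4`, then convolve `b² = 4` copies);
normalisation is irrelevant and omitted. [cite: Ito1984AnalyticMK, eq. (3)] -/
def mkFunStep (F : ℝ → ℝ) : ℝ → ℝ :=
  pconv (pconv (pconv (fun x => F x ^ 4) (fun x => F x ^ 4)) (fun x => F x ^ 4)) (fun x => F x ^ 4)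

/-- The MK orbit of the `U(1)` Wilson weight `exp(β cos θ)` in function space (unnormalised).
[cite: Ito1984AnalyticMK, eqs. (3), (4b)] -/
def mkFun (β : ℝ) : ℕ → ℝ → ℝ
  | 0 => fun θ => Real.exp (β * Real.cos θ)
  | n + 1 => mkFunStep (mkFun β n)

/-- The explicit decreasing sequence of curvature bounds `B₀ = β`,
`B_{n+1} = (1 - e^{-4π²B_n}/4) B_n`. [folklore] -/
def bseq (β : ℝ) : ℕ → ℝ
  | 0 => β
  | n + 1 => (1 - Real.exp (-(4 * π ^ 2 * bseq β n)) / 4) * bseq β n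

/-- The recursion for `bseq`. [folklore] -/
theorem bseq_succ (β : ℝ) (n : ℕ) :
    bseq β (n + 1) = (1 - Real.exp (-(4 * π ^ 2 * bseq β n)) / 4) * bseq β n := rfl

/-- `0 ≤ B_n`. [folklore] -/
theorem bseq_nonneg {β : ℝ} (hβ : 0 ≤ β) : ∀ n, 0 ≤ bseq β n
  | 0 => hβ
  | n + 1 => by
    rw [bseq_succ]
    refine mul_nonneg ?_ (bseq_nonneg hβ n)
    have : Real.exp (-(4 * π ^ 2 * bseq β n)) ≤ 1 := by
      rw [Real.exp_le_one_iff, neg_nonpos]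
      exact mul_nonneg (by positivity) (bseq_nonneg hβ n)
    linarith

/-- `B_n ≤ β`. [folklore] -/
theorem bseq_le {β : ℝ} (hβ : 0 ≤ β) : ∀ n, bseq β n ≤ β
  | 0 => le_rfl
  | n + 1 => by
    rw [bseq_succ]
    have h1 : (1 - Real.exp (-(4 * π ^ 2 * bseq β n)) / 4) ≤ 1 := by
      linarith [Real.exp_pos (-(4 * π ^ 2 * bseq β n))]
    calc (1 - Real.exp (-(4 * π ^ 2 * bseq β n)) / 4) * bseq β n ≤ 1 * bseq β n :=
          mul_le_mul_of_nonneg_right h1 (bseq_nonneg hβ n)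
      _ ≤ β := by rw [one_mul]; exact bseq_le hβ n

/-- `B_n ≤ qⁿ β` with `q = 1 - e^{-4π²β}/4 < 1`. [folklore] -/
theorem bseq_le_geom {β : ℝ} (hβ : 0 ≤ β) :
    ∀ n, bseq β n ≤ (1 - Real.exp (-(4 * π ^ 2 * β)) / 4) ^ n * β
  | 0 => by simp [bseq]
  | n + 1 => by
    rw [bseq_succ, pow_succ]
    have hq : 1 - Real.exp (-(4 * π ^ 2 * bseq β n)) / 4 ≤
        1 - Real.exp (-(4 * π ^ 2 * β)) / 4 := by
      have : Real.exp (-(4 * π ^ 2 * β)) ≤ Real.exp (-(4 * π ^ 2 * bseq β n)) := by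
        apply Real.exp_le_exp.2
        have := bseq_le hβ n
        nlinarith [pi_pos, sq_nonneg π]
      linarith
    have hq0 : 0 ≤ 1 - Real.exp (-(4 * π ^ 2 * bseq β n)) / 4 := by
      linarith [Real.exp_le_one_iff.2
        (neg_nonpos.2 (mul_nonneg (by positivity : (0:ℝ) ≤ 4 * π ^ 2) (bseq_nonneg hβ n)))]
    calc (1 - Real.exp (-(4 * π ^ 2 * bseq β n)) / 4) * bseq β n
        ≤ (1 - Real.exp (-(4 * π ^ 2 * β)) / 4) *
            ((1 - Real.exp (-(4 * π ^ 2 * β)) / 4) ^ n * β) :=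
          mul_le_mul hq (bseq_le_geom hβ n) (bseq_nonneg hβ n) (hq0.trans hq)
      _ = (1 - Real.exp (-(4 * π ^ 2 * β)) / 4) ^ n *
            (1 - Real.exp (-(4 * π ^ 2 * β)) / 4) * β := by
          ring

/-- `B_n → 0`. [folklore] -/
theorem tendsto_bseq {β : ℝ} (hβ : 0 ≤ β) : Tendsto (bseq β) atTop (nhds 0) := by
  have hq1 : 1 - Real.exp (-(4 * π ^ 2 * β)) / 4 < 1 := by
    linarith [Real.exp_pos (-(4 * π ^ 2 * β))]
  have hq0 : 0 ≤ 1 - Real.exp (-(4 * π ^ 2 * β)) / 4 := by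
    linarith [Real.exp_le_one_iff.2
      (neg_nonpos.2 (mul_nonneg (by positivity : (0:ℝ) ≤ 4 * π ^ 2) hβ))]
  have hgeom : Tendsto (fun n => (1 - Real.exp (-(4 * π ^ 2 * β)) / 4) ^ n * β)
      atTop (nhds 0) := by
    simpa using (tendsto_pow_atTop_nhds_zero_of_lt_one hq0 hq1).mul_const β
  exact squeeze_zero (bseq_nonneg hβ) (bseq_le_geom hβ) hgeom

/-- The initial weight `exp(β cos θ)` is nice, with curvature `b = β cos θ ≤ β`. [folklore] -/
theorem niceFun_exp_cos {β : ℝ} (hβ : 0 ≤ β) :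
    NiceFun (fun θ => Real.exp (β * Real.cos θ))
      (fun θ => -(β * Real.sin θ) * Real.exp (β * Real.cos θ))
      (fun θ => (β ^ 2 * Real.sin θ ^ 2 - β * Real.cos θ) * Real.exp (β * Real.cos θ)) ∧
    ∀ θ, (-(β * Real.sin θ) * Real.exp (β * Real.cos θ)) ^ 2 -
        (β ^ 2 * Real.sin θ ^ 2 - β * Real.cos θ) * Real.exp (β * Real.cos θ) *
          Real.exp (β * Real.cos θ) ≤ β * Real.exp (β * Real.cos θ) ^ 2 := by
  have hd1 : ∀ θ, HasDerivAt (fun θ => Real.exp (β * Real.cos θ))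
      (-(β * Real.sin θ) * Real.exp (β * Real.cos θ)) θ := fun θ => by
    have := ((Real.hasDerivAt_cos θ).const_mul β).exp
    refine this.congr_deriv ?_
    ring
  refine ⟨⟨?_, ?_, ?_, hd1, ?_, ?_⟩, ?_⟩
  · intro θ
    simp only [Real.cos_add_two_pi]
  · intro θ
    simp only [Real.cos_neg]
  · intro θ; exact Real.exp_pos _
  · intro θ
    have := ((Real.hasDerivAt_sin θ).const_mul β).fun_neg.fun_mul (hd1 θ)
    refine this.congr_deriv ?_
    ring
  · fun_prop
  · intro θ
    have h1 : β * Real.cos θ ≤ β := by nlinarith [Real.cos_le_one θ]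
    have h2 := Real.exp_pos (β * Real.cos θ)
    nlinarith [mul_le_mul_of_nonneg_right h1 (le_of_lt (pow_pos h2 2))]

/-- **One MK step contracts the curvature bound**: if `b_F ≤ B` (`B ≥ 0`) for a nice weight `F`,
then `mkFunStep F` is nice with `b ≤ (1 - e^{-4π²B}/4) B`. This is the quantitative form, for
`U(1)`, of Ito's "`{β⁽ⁿ⁾}` are monotone decreasing … `β⁽ⁿ⁺¹⁾ - β⁽ⁿ⁾ ≤ -κ`".
[cite: Ito1987HierarchicalHeisenberg, §3 eqs. (21)–(22)] -/
theorem mkFunStep_spec {F F' F'' : ℝ → ℝ} (h : NiceFun F F' F'') {B : ℝ} (hB : 0 ≤ B)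
    (hc : ∀ x, F' x ^ 2 - F'' x * F x ≤ B * F x ^ 2) :
    ∃ G' G'', NiceFun (mkFunStep F) G' G'' ∧
      ∀ x, G' x ^ 2 - G'' x * mkFunStep F x ≤
        ((1 - Real.exp (-(4 * π ^ 2 * B)) / 4) * B) * mkFunStep F x ^ 2 := by
  obtain ⟨M, hM0, hMle, hMge⟩ := exists_bounds_of_curv h hB hc
  set r := Real.exp (-(B * π ^ 2 / 2)) with hr
  have hr0 : 0 < r := Real.exp_pos _
  have hr1 : r ≤ 1 := by
    rw [hr, Real.exp_le_one_iff, neg_nonpos]; positivity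
  have hr8 : r ^ 8 = Real.exp (-(4 * π ^ 2 * B)) := by
    have e : ((8 : ℕ) : ℝ) * (-(B * π ^ 2 / 2)) = -(4 * π ^ 2 * B) := by push_cast; ring
    rw [hr, ← Real.exp_nat_mul, e]
  set m := M * r with hm
  have hm0 : 0 < m := mul_pos hM0 hr0
  -- the fourth power
  have hH := h.pow4
  set H : ℝ → ℝ := fun x => F x ^ 4 with hHdef
  set H' : ℝ → ℝ := fun x => 4 * F x ^ 3 * F' x
  set H'' : ℝ → ℝ := fun x => 12 * F x ^ 2 * F' x ^ 2 + 4 * F x ^ 3 * F'' x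
  have hcH : ∀ x, H' x ^ 2 - H'' x * H x ≤ (4 * B) * H x ^ 2 := by
    intro x
    have e1 : H' x ^ 2 - H'' x * H x = 4 * F x ^ 6 * (F' x ^ 2 - F'' x * F x) := by
      simp only [H, H', H'']; ring
    have e2 : (4 * B) * H x ^ 2 = 4 * F x ^ 6 * (B * F x ^ 2) := by
      simp only [H]; ring
    rw [e1, e2]
    exact mul_le_mul_of_nonneg_left (hc x) (by positivity)
  have hmH : ∀ x, m ^ 4 ≤ H x := fun x => pow_le_pow_left₀ hm0.le (hMge x) 4
  have hMH : ∀ x, H x ≤ M ^ 4 := fun x => pow_le_pow_left₀ (h.pos x).le (hMle x) 4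
  have hB4 : 0 ≤ 4 * B := by positivity
  have hρ : m ^ 4 * m ^ 4 / (M ^ 4 * M ^ 4) = r ^ 8 := by
    rw [hm, div_eq_iff (by positivity)]; ring
  -- K2 = H ⋆ H, α = 1/2, with the gain
  have hK2 := hH.pconv hH
  have hcK2 : ∀ x, pconv H' H x ^ 2 - pconv H'' H x * pconv H H x ≤
      ((2 - r ^ 8) * B) * pconv H H x ^ 2 := by
    intro x
    have := curv_pconv hH hH hB4 hcH hcH hmH hMH hmH hMH (pow_pos hm0 4) (pow_pos hm0 4)
      (1 / 2) x
    rw [hρ] at this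
    refine this.trans (le_of_eq ?_)
    ring
  have hB2 : 0 ≤ (2 - r ^ 8) * B :=
    mul_nonneg (by nlinarith [pow_le_one₀ hr0.le hr1 (n := 8)]) hB
  have hmK2 : ∀ x, 2 * π * (m ^ 4 * m ^ 4) ≤ pconv H H x :=
    le_pconv hH.continuous hH.continuous hmH hmH (pow_pos hm0 4).le (pow_pos hm0 4).le
  have hMK2 : ∀ x, pconv H H x ≤ 2 * π * (M ^ 4 * M ^ 4) :=
    pconv_le hH.continuous hH.continuous hMH hMH (fun x => (hH.pos x).le)
      (fun x => (hH.pos x).le)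
  have hmK20 : 0 < 2 * π * (m ^ 4 * m ^ 4) := by positivity
  -- K3 = K2 ⋆ H, α = 2/3, no gain
  have hK3 := hK2.pconv hH
  have hcK3 : ∀ x, pconv (pconv H' H) H x ^ 2 -
      pconv (pconv H'' H) H x * pconv (pconv H H) H x ≤
      ((4 / 9) * (3 - r ^ 8) * B) * pconv (pconv H H) H x ^ 2 := by
    intro x
    have := curv_pconv' hK2 hH hB2 hcK2 hcH hmK2 hMK2 hmH hMH hmK20 (pow_pos hm0 4) (2 / 3) x
    refine this.trans (le_of_eq ?_)
    ring
  have hB3 : 0 ≤ (4 / 9) * (3 - r ^ 8) * B :=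
    mul_nonneg (mul_nonneg (by norm_num) (by nlinarith [pow_le_one₀ hr0.le hr1 (n := 8)])) hB
  have hmK3 : ∀ x, 2 * π * (2 * π * (m ^ 4 * m ^ 4) * m ^ 4) ≤ pconv (pconv H H) H x :=
    le_pconv hK2.continuous hH.continuous hmK2 hmH hmK20.le (pow_pos hm0 4).le
  have hMK3 : ∀ x, pconv (pconv H H) H x ≤ 2 * π * (2 * π * (M ^ 4 * M ^ 4) * M ^ 4) :=
    pconv_le hK2.continuous hH.continuous hMK2 hMH (fun x => (hK2.pos x).le)
      (fun x => (hH.pos x).le)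
  have hmK30 : 0 < 2 * π * (2 * π * (m ^ 4 * m ^ 4) * m ^ 4) := by positivity
  -- K4 = K3 ⋆ H, α = 3/4, no gain
  have hK4 := hK3.pconv hH
  refine ⟨_, _, hK4, fun x => ?_⟩
  have := curv_pconv' hK3 hH hB3 hcK3 hcH hmK3 hMK3 hmH hMH hmK30 (pow_pos hm0 4) (3 / 4) x
  rw [← hr8]
  refine this.trans (le_of_eq ?_)
  simp only [mkFunStep]
  ring

/-- **The orbit stays nice and its curvature bound follows `bseq`.** [folklore] -/
theorem mkFun_spec {β : ℝ} (hβ : 0 ≤ β) : ∀ n, ∃ F' F'', NiceFun (mkFun β n) F' F'' ∧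
    ∀ x, F' x ^ 2 - F'' x * mkFun β n x ≤ bseq β n * mkFun β n x ^ 2
  | 0 => by
    obtain ⟨h1, h2⟩ := niceFun_exp_cos hβ
    exact ⟨_, _, h1, h2⟩
  | n + 1 => by
    obtain ⟨F', F'', hF, hc⟩ := mkFun_spec hβ n
    obtain ⟨G', G'', hG, hcG⟩ := mkFunStep_spec hF (bseq_nonneg hβ n) hc
    exact ⟨G', G'', hG, hcG⟩

/-! ### Fourier cosine coefficients over one period -/

/-- Unnormalised Fourier cosine coefficient over one period,
`fc f j = ∫_{-π}^{π} f(θ) cos(jθ) dθ`. [folklore] -/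
def fc (f : ℝ → ℝ) (j : ℤ) : ℝ := ∫ θ in (-π)..π, f θ * Real.cos (j * θ)

/-- `fc f (-j) = fc f j`. [folklore] -/
theorem fc_neg_index (f : ℝ → ℝ) (j : ℤ) : fc f (-j) = fc f j := by
  simp only [fc, Int.cast_neg, neg_mul, Real.cos_neg]

/-- `|fc f j| ≤ 2π C` if `|f| ≤ C` on `[-π, π]`. [folklore] -/
theorem abs_fc_le {f : ℝ → ℝ} (hf : Continuous f) {C : ℝ} (hC : ∀ x ∈ Icc (-π) π, |f x| ≤ C)
    (j : ℤ) : |fc f j| ≤ 2 * π * C := by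
  unfold fc
  calc |∫ θ in (-π)..π, f θ * Real.cos (j * θ)|
      ≤ ∫ θ in (-π)..π, |f θ * Real.cos (j * θ)| :=
        intervalIntegral.abs_integral_le_integral_abs (by linarith [pi_pos])
    _ ≤ ∫ _ in (-π)..π, C := by
        refine intervalIntegral.integral_mono_on (by linarith [pi_pos])
          ((Continuous.abs (by fun_prop)).intervalIntegrable _ _) intervalIntegrable_const
          fun θ hθ => ?_
        rw [abs_mul]
        calc |f θ| * |Real.cos (j * θ)| ≤ |f θ| * 1 :=
              mul_le_mul_of_nonneg_left (Real.abs_cos_le_one _) (abs_nonneg _)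
          _ ≤ C := by rw [mul_one]; exact hC θ hθ
    _ = 2 * π * C := by
        rw [intervalIntegral.integral_const, smul_eq_mul]; ring

/-- The integral of an odd function over `[-π, π]` vanishes. [folklore] -/
theorem integral_eq_zero_of_odd {u : ℝ → ℝ} (hu : ∀ x, u (-x) = -u x) :
    ∫ x in (-π)..π, u x = 0 := by
  have h := intervalIntegral.integral_comp_neg (a := -π) (b := π) (f := u)
  simp only [neg_neg, hu, intervalIntegral.integral_neg] at h
  linarith

/-- **Decay of the Fourier coefficients of a `C²` periodic function**:
`fc f j = -fc f″ j / j²` for `j ≠ 0`. [folklore] -/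
theorem fc_eq_neg_fc_deriv2_div {f f' f'' : ℝ → ℝ} (hper : Periodic f (2 * π))
    (hd : ∀ x, HasDerivAt f (f' x) x) (hd' : ∀ x, HasDerivAt f' (f'' x) x)
    (hc'' : Continuous f'') {j : ℤ} (hj : j ≠ 0) : fc f j = -fc f'' j / (j : ℝ) ^ 2 := by
  have hj' : (j : ℝ) ≠ 0 := Int.cast_ne_zero.2 hj
  have hfc : Continuous f := continuous_iff_continuousAt.2 fun x => (hd x).continuousAt
  have hf'c : Continuous f' := continuous_iff_continuousAt.2 fun x => (hd' x).continuousAt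
  -- periodicity of `f'`
  have hper' : Periodic f' (2 * π) := by
    intro x
    have h1 : HasDerivAt (fun y => f (y + 2 * π)) (f' (x + 2 * π)) x :=
      (hd (x + 2 * π)).comp_add_const x (2 * π)
    rw [show (fun y => f (y + 2 * π)) = f from funext fun y => hper y] at h1
    exact h1.unique (hd x)
  have hcosper : ∀ x, Real.cos (j * (x + 2 * π)) = Real.cos (j * x) := fun x => by
    rw [mul_add, show (j : ℝ) * (2 * π) = j * (2 * π) from rfl, Real.cos_add_int_mul_two_pi]
  have hsinper : ∀ x, Real.sin (j * (x + 2 * π)) = Real.sin (j * x) := fun x => by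
    rw [mul_add, Real.sin_add_int_mul_two_pi]
  -- first integration by parts: `∫ f cos(j·) = -(1/j) ∫ f' sin(j·)`
  have h1 : ∫ x in (-π)..π, (f' x * Real.sin (j * x) + f x * (j * Real.cos (j * x))) = 0 := by
    refine integral_deriv_eq_zero_of_periodic (g := fun x => f x * Real.sin (j * x))
      (fun x => ?_) (by fun_prop) (fun x => by simp only [hper x, hsinper x])
    have := (hd x).fun_mul (((hasDerivAt_id' x).const_mul (j : ℝ)).sin)
    refine this.congr_deriv ?_
    ring
  -- second: `∫ f' sin(j·) = (1/j) ∫ f'' cos(j·)`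
  have h2 : ∫ x in (-π)..π, (f'' x * Real.sin (j * x) + f' x * (j * Real.cos (j * x))) = 0 := by
    refine integral_deriv_eq_zero_of_periodic (g := fun x => f' x * Real.sin (j * x))
      (fun x => ?_) (by fun_prop) (fun x => by simp only [hper' x, hsinper x])
    have := (hd' x).fun_mul (((hasDerivAt_id' x).const_mul (j : ℝ)).sin)
    refine this.congr_deriv ?_
    ring
  rw [intervalIntegral.integral_add (by apply Continuous.intervalIntegrable; fun_prop)
    (by apply Continuous.intervalIntegrable; fun_prop)] at h1 h2
  have e1 : ∫ x in (-π)..π, f x * (j * Real.cos (j * x)) = j * fc f j := by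
    rw [fc, ← intervalIntegral.integral_const_mul]
    exact intervalIntegral.integral_congr fun x _ => by ring
  have e2 : ∫ x in (-π)..π, f' x * (j * Real.cos (j * x)) =
      j * ∫ x in (-π)..π, f' x * Real.cos (j * x) := by
    rw [← intervalIntegral.integral_const_mul]
    exact intervalIntegral.integral_congr fun x _ => by ring
  -- third: `∫ f'' sin = -(j) ∫ f' cos`... we instead differentiate `f' cos(j·)`:
  have h3 : ∫ x in (-π)..π, (f'' x * Real.cos (j * x) + f' x * (-(j * Real.sin (j * x)))) = 0 := by
    refine integral_deriv_eq_zero_of_periodic (g := fun x => f' x * Real.cos (j * x))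
      (fun x => ?_) (by fun_prop) (fun x => by simp only [hper' x, hcosper x])
    have := (hd' x).fun_mul (((hasDerivAt_id' x).const_mul (j : ℝ)).cos)
    refine this.congr_deriv ?_
    ring
  rw [intervalIntegral.integral_add (by apply Continuous.intervalIntegrable; fun_prop)
    (by apply Continuous.intervalIntegrable; fun_prop)] at h3
  have e3 : ∫ x in (-π)..π, f' x * (-(j * Real.sin (j * x))) =
      -(j * ∫ x in (-π)..π, f' x * Real.sin (j * x)) := by
    rw [← intervalIntegral.integral_const_mul, ← intervalIntegral.integral_neg]
    exact intervalIntegral.integral_congr fun x _ => by ring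
  rw [e1] at h1
  rw [e3] at h3
  -- h1 : ∫ f' sin + j fc f j = 0 ;  h3 : fc f'' j - j ∫ f' sin = 0
  have : (j : ℝ) ^ 2 * fc f j = -fc f'' j := by
    have h3' : ∫ x in (-π)..π, f' x * Real.sin (j * x) = fc f'' j / j := by
      rw [fc, eq_div_iff hj']; linarith
    rw [h3'] at h1
    field_simp at h1
    linarith
  rw [eq_div_iff (pow_ne_zero 2 hj'), mul_comm]
  linarith

/-- The Fourier cosine coefficients of a `C²` periodic function are absolutely summable.
[folklore] -/
theorem summable_abs_fc {f f' f'' : ℝ → ℝ} (hper : Periodic f (2 * π))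
    (hd : ∀ x, HasDerivAt f (f' x) x) (hd' : ∀ x, HasDerivAt f' (f'' x) x)
    (hc'' : Continuous f'') : Summable fun j : ℤ => |fc f j| := by
  obtain ⟨C, hC⟩ : ∃ C, ∀ x ∈ Icc (-π) π, ‖f'' x‖ ≤ C :=
    isCompact_Icc.exists_bound_of_continuousOn hc''.continuousOn
  have hC' : ∀ x ∈ Icc (-π) π, |f'' x| ≤ C := fun x hx => by
    simpa only [Real.norm_eq_abs] using hC x hx
  have hbd : ∀ j : ℤ, j ≠ 0 → |fc f j| ≤ 2 * π * C * (1 / (j : ℝ) ^ 2) := by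
    intro j hj
    have hj' : (j : ℝ) ≠ 0 := Int.cast_ne_zero.2 hj
    have hj2 : 0 < (j : ℝ) ^ 2 := by positivity
    rw [fc_eq_neg_fc_deriv2_div hper hd hd' hc'' hj, abs_div, abs_neg, abs_of_pos hj2,
      mul_one_div]
    exact div_le_div_of_nonneg_right (abs_fc_le hc'' hC' j) hj2.le
  refine Summable.of_norm_bounded_eventually (g := fun j : ℤ => 2 * π * C * (1 / (j : ℝ) ^ 2))
    ((summable_one_div_int_pow.2 one_lt_two).mul_left _) ?_
  filter_upwards [eventually_cofinite_ne 0] with j hj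
  rw [Real.norm_eq_abs, abs_abs]
  exact hbd j hj

/-! ### Pointwise Fourier inversion for even periodic functions (transfer from `AddCircle`) -/

/-- The Fourier character on `AddCircle (2π)` at a real point. [folklore] -/
theorem fourier_two_pi_coe (n : ℤ) (x : ℝ) :
    fourier n (x : AddCircle (2 * π)) =
      (Real.cos (n * x) : ℂ) + (Real.sin (n * x) : ℂ) * Complex.I := by
  rw [fourier_coe_apply]
  have hπ : (π : ℂ) ≠ 0 := Complex.ofReal_ne_zero.2 Real.pi_ne_zero
  have e : (2 * π * Complex.I * n * x / (2 * π : ℝ) : ℂ) = ((n * x : ℝ) : ℂ) * Complex.I := by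
    push_cast
    field_simp
  rw [e, Complex.exp_mul_I, ← Complex.ofReal_cos, ← Complex.ofReal_sin]

/-- The conjugate Fourier character on `AddCircle (2π)` at a real point. [folklore] -/
theorem fourier_two_pi_coe_neg (n : ℤ) (x : ℝ) :
    fourier (-n) (x : AddCircle (2 * π)) =
      (Real.cos (n * x) : ℂ) - (Real.sin (n * x) : ℂ) * Complex.I := by
  rw [fourier_two_pi_coe]
  simp only [Int.cast_neg, neg_mul, Real.cos_neg, Real.sin_neg, Complex.ofReal_neg]
  ring

/-- **Pointwise Fourier inversion, real even form.** A continuous even `2π`-periodic `g` with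
absolutely summable cosine coefficients is the sum of its Fourier cosine series:
`g(x) = Σ_{k ∈ ℤ} (fc g k / 2π) cos(kx)` (transfer of Mathlib's
`has_pointwise_sum_fourier_series_of_summable` on `AddCircle (2π)`). [folklore] -/
theorem hasSum_fc_cos {g : ℝ → ℝ} (hg : Continuous g) (hper : Periodic g (2 * π))
    (heven : ∀ x, g (-x) = g x) (hsum : Summable fun k : ℤ => |fc g k|) (x : ℝ) :
    HasSum (fun k : ℤ => fc g k / (2 * π) * Real.cos (k * x)) (g x) := by
  haveI hT : Fact (0 < 2 * π) := ⟨two_pi_pos'⟩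
  have hgc_per : Periodic (fun y => (g y : ℂ)) (2 * π) := fun y => by
    simp only [hper y]
  have hgc_cont : Continuous fun y => (g y : ℂ) := by fun_prop
  have hGcont : Continuous hgc_per.lift :=
    Continuous.quotient_liftOn' hgc_cont _
  let G : C(AddCircle (2 * π), ℂ) := ⟨hgc_per.lift, hGcont⟩
  have hGval : ∀ y : ℝ, G (y : AddCircle (2 * π)) = (g y : ℂ) := fun y => hgc_per.lift_coe y
  -- the Fourier coefficients of `G`
  have hcoef : ∀ n : ℤ, fourierCoeff G n = ((fc g n / (2 * π) : ℝ) : ℂ) := by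
    intro n
    rw [fourierCoeff_eq_intervalIntegral G n (-π), neg_pi_add_two_pi]
    have e : ∀ y : ℝ, fourier (-n) (y : AddCircle (2 * π)) • G (y : AddCircle (2 * π)) =
        ((g y * Real.cos (n * y) : ℝ) : ℂ) + ((-(g y * Real.sin (n * y)) : ℝ) : ℂ) * Complex.I := by
      intro y
      rw [hGval, fourier_two_pi_coe_neg, smul_eq_mul]
      push_cast
      ring
    simp_rw [e]
    rw [intervalIntegral.integral_add (by apply Continuous.intervalIntegrable; fun_prop)
      (by apply Continuous.intervalIntegrable; fun_prop), intervalIntegral.integral_mul_const,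
      intervalIntegral.integral_ofReal, intervalIntegral.integral_ofReal,
      integral_eq_zero_of_odd (u := fun y => -(g y * Real.sin (n * y))) (fun y => by
        simp only [heven, mul_neg, Real.sin_neg, neg_neg])]
    rw [fc, Complex.real_smul]
    push_cast
    ring
  have hGsum : Summable (fourierCoeff G) := by
    refine Summable.of_norm ?_
    simp_rw [hcoef, Complex.norm_real, Real.norm_eq_abs, abs_div, abs_of_pos two_pi_pos']
    exact hsum.div_const _
  have hp := has_pointwise_sum_fourier_series_of_summable hGsum (x : AddCircle (2 * π))
  rw [hGval] at hp
  simp_rw [hcoef, fourier_two_pi_coe, smul_eq_mul] at hp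
  have hre := Complex.hasSum_re hp
  simp only [Complex.ofReal_re] at hre
  convert hre using 1
  ext k
  simp only [Complex.mul_re, Complex.add_re, Complex.ofReal_re, Complex.mul_im, Complex.add_im,
    Complex.ofReal_im, Complex.I_re, Complex.I_im]
  ring

/-- **Fourier coefficients of a product** (real even form): for continuous `f` and a continuous
even `2π`-periodic `g` with absolutely summable cosine coefficients,
`Σ_k fc g k · fc f (j - k) = 2π · fc (f g) j`. [folklore] -/
theorem hasSum_fc_mul_fc {f g : ℝ → ℝ} (hf : Continuous f) (hg : Continuous g)
    (hgper : Periodic g (2 * π)) (hgeven : ∀ x, g (-x) = g x)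
    (hsum : Summable fun k : ℤ => |fc g k|) (j : ℤ) :
    HasSum (fun k : ℤ => fc g k * fc f (j - k)) (2 * π * fc (fun x => f x * g x) j) := by
  obtain ⟨Cf, hCf⟩ : ∃ C, ∀ x ∈ Icc (-π) π, ‖f x‖ ≤ C :=
    isCompact_Icc.exists_bound_of_continuousOn hf.continuousOn
  have hCf' : ∀ x ∈ Icc (-π) π, |f x| ≤ Cf := fun x hx => by
    simpa only [Real.norm_eq_abs] using hCf x hx
  have hCf0 : 0 ≤ Cf := (norm_nonneg _).trans (hCf 0 ⟨by linarith [pi_pos], by linarith [pi_pos]⟩)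
  -- pointwise expansion of `g`, multiplied by `f cos(j·)`
  have hpt : ∀ x, HasSum
      (fun k : ℤ => f x * Real.cos (j * x) * (fc g k / (2 * π) * Real.cos (k * x)))
      (f x * Real.cos (j * x) * g x) := fun x =>
    (hasSum_fc_cos hg hgper hgeven hsum x).mul_left _
  -- termwise integration
  have hint : HasSum (fun k : ℤ => ∫ x in (-π)..π,
      f x * Real.cos (j * x) * (fc g k / (2 * π) * Real.cos (k * x)))
      (∫ x in (-π)..π, f x * Real.cos (j * x) * g x) := by
    refine intervalIntegral.hasSum_integral_of_dominated_convergence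
      (fun k _ => Cf * (|fc g k| / (2 * π))) (fun k => ?_) (fun k => ?_) ?_ ?_ ?_
    · exact (by fun_prop : Continuous fun x =>
        f x * Real.cos (j * x) * (fc g k / (2 * π) * Real.cos (k * x))).aestronglyMeasurable
    · refine ae_of_all _ fun x hx => ?_
      rw [uIoc_of_le (by linarith [pi_pos])] at hx
      rw [Real.norm_eq_abs, abs_mul, abs_mul, abs_mul, abs_div, abs_of_pos two_pi_pos']
      have h1 : |f x| ≤ Cf := hCf' x ⟨hx.1.le, hx.2⟩
      have h2 : |Real.cos (j * x)| ≤ 1 := Real.abs_cos_le_one _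
      have h3 : |Real.cos (k * x)| ≤ 1 := Real.abs_cos_le_one _
      have h4 : 0 ≤ |fc g k| / (2 * π) := by positivity
      calc |f x| * |Real.cos (j * x)| * (|fc g k| / (2 * π) * |Real.cos (k * x)|)
          ≤ Cf * 1 * (|fc g k| / (2 * π) * 1) := by
            gcongr
      _ = Cf * (|fc g k| / (2 * π)) := by ring
    · exact ae_of_all _ fun x _ => (hsum.div_const (2 * π)).mul_left Cf
    · exact intervalIntegrable_const
    · exact ae_of_all _ fun x _ => hpt x
  -- evaluate each term
  have hterm : ∀ k : ℤ, ∫ x in (-π)..π,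
      f x * Real.cos (j * x) * (fc g k / (2 * π) * Real.cos (k * x)) =
      fc g k / (4 * π) * fc f (j - k) + fc g k / (4 * π) * fc f (j + k) := by
    intro k
    have e : ∀ x, f x * Real.cos (j * x) * (fc g k / (2 * π) * Real.cos (k * x)) =
        fc g k / (4 * π) * (f x * Real.cos (((j - k : ℤ) : ℝ) * x)) +
          fc g k / (4 * π) * (f x * Real.cos (((j + k : ℤ) : ℝ) * x)) := by
      intro x
      push_cast
      rw [sub_mul, add_mul, Real.cos_sub, Real.cos_add]
      ring
    simp_rw [e]
    rw [intervalIntegral.integral_add (by apply Continuous.intervalIntegrable; fun_prop)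
      (by apply Continuous.intervalIntegrable; fun_prop), intervalIntegral.integral_const_mul,
      intervalIntegral.integral_const_mul]
    rfl
  have hR : ∫ x in (-π)..π, f x * Real.cos (j * x) * g x = fc (fun x => f x * g x) j := by
    simp only [fc]
    exact intervalIntegral.integral_congr fun x _ => by ring
  rw [hR] at hint
  simp_rw [hterm] at hint
  -- both halves are summable
  have hbdf : ∀ m : ℤ, |fc f m| ≤ 2 * π * Cf := abs_fc_le hf hCf'
  have hs1 : Summable fun k : ℤ => fc g k / (4 * π) * fc f (j - k) := by
    refine Summable.of_norm_bounded (g := fun k => |fc g k| / (4 * π) * (2 * π * Cf))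
      ((hsum.div_const _).mul_right _) fun k => ?_
    rw [Real.norm_eq_abs, abs_mul, abs_div, abs_of_pos (by positivity : (0:ℝ) < 4 * π)]
    exact mul_le_mul_of_nonneg_left (hbdf _) (by positivity)
  have hs2 : Summable fun k : ℤ => fc g k / (4 * π) * fc f (j + k) := by
    refine Summable.of_norm_bounded (g := fun k => |fc g k| / (4 * π) * (2 * π * Cf))
      ((hsum.div_const _).mul_right _) fun k => ?_
    rw [Real.norm_eq_abs, abs_mul, abs_div, abs_of_pos (by positivity : (0:ℝ) < 4 * π)]
    exact mul_le_mul_of_nonneg_left (hbdf _) (by positivity)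
  have hsplit := hs1.hasSum.add hs2.hasSum
  have huniq := hint.unique hsplit
  -- the two halves coincide (reindex `k ↦ -k`)
  have hreindex : ∑' k : ℤ, fc g k / (4 * π) * fc f (j + k) =
      ∑' k : ℤ, fc g k / (4 * π) * fc f (j - k) := by
    rw [← (Equiv.neg ℤ).tsum_eq]
    refine tsum_congr fun k => ?_
    simp only [Equiv.neg_apply, fc_neg_index, ← sub_eq_add_neg]
  rw [hreindex] at huniq
  have hval : ∑' k : ℤ, fc g k / (4 * π) * fc f (j - k) = fc (fun x => f x * g x) j / 2 := by
    linarith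
  have hs1' : Summable fun k : ℤ => fc g k * fc f (j - k) := by
    have := hs1.mul_left (4 * π)
    refine this.congr fun k => ?_
    field_simp
  have htsum : ∑' k : ℤ, fc g k * fc f (j - k) = 2 * π * fc (fun x => f x * g x) j := by
    have : ∑' k : ℤ, fc g k * fc f (j - k) =
        (4 * π) * ∑' k : ℤ, fc g k / (4 * π) * fc f (j - k) := by
      rw [← tsum_mul_left]
      refine tsum_congr fun k => ?_
      field_simp
    rw [this, hval]
    ring
  rw [← htsum]
  exact hs1'.hasSum

/-- **Fourier coefficients of a periodic convolution**: for continuous `P`, `Q` with `P` even and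
`2π`-periodic, `fc (P ⋆ Q) j = fc P j · fc Q j`. [folklore] -/
theorem fc_pconv {P Q : ℝ → ℝ} (hP : Continuous P) (hQ : Continuous Q) (hPper : Periodic P (2 * π))
    (hPeven : ∀ x, P (-x) = P x) (j : ℤ) : fc (pconv P Q) j = fc P j * fc Q j := by
  unfold fc pconv
  have h1 : ∀ θ, (∫ t in (-π)..π, P (θ - t) * Q t) * Real.cos (j * θ) =
      ∫ t in (-π)..π, P (θ - t) * Q t * Real.cos (j * θ) := fun θ => by
    rw [← intervalIntegral.integral_mul_const]
  simp_rw [h1]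
  rw [MeasureTheory.intervalIntegral_intervalIntegral_swap]
  swap
  · have hc : Continuous (Function.uncurry fun θ t => P (θ - t) * Q t * Real.cos (j * θ)) := by
      exact ((hP.comp (continuous_fst.sub continuous_snd)).mul (hQ.comp continuous_snd)).mul
        ((Real.continuous_cos).comp (continuous_const.mul continuous_fst))
    exact (hc.continuousOn.integrableOn_compact (isCompact_uIcc.prod isCompact_uIcc)).mono_set
      (Set.prod_mono uIoc_subset_uIcc uIoc_subset_uIcc)
  -- inner integral: `∫ P(θ - t) cos(jθ) dθ = cos(jt) · fc P j`
  have h2 : ∀ t, ∫ θ in (-π)..π, P (θ - t) * Q t * Real.cos (j * θ) =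
      Q t * Real.cos (j * t) * ∫ θ in (-π)..π, P θ * Real.cos (j * θ) := by
    intro t
    have hperI : Periodic (fun θ => P (θ - t) * Q t * Real.cos (j * θ)) (2 * π) := fun θ => by
      show P (θ + 2 * π - t) * Q t * Real.cos (j * (θ + 2 * π)) = P (θ - t) * Q t * Real.cos (j * θ)
      rw [show θ + 2 * π - t = θ - t + 2 * π by ring, hPper, mul_add, Real.cos_add_int_mul_two_pi]
    -- shift the window by `t`
    have hshift := hperI.intervalIntegral_add_eq (-π) (-π + t)
    rw [neg_pi_add_two_pi, show -π + t + 2 * π = π + t by ring] at hshift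
    rw [hshift]
    -- substitute `θ = u + t`
    have hsub := intervalIntegral.integral_comp_add_right
      (fun θ => P (θ - t) * Q t * Real.cos (j * θ)) t (a := -π) (b := π)
    simp only [add_sub_cancel_right] at hsub
    rw [← hsub]
    -- expand `cos(j(u+t))` and kill the odd part
    have e : ∀ u, P u * Q t * Real.cos (j * (u + t)) =
        Q t * Real.cos (j * t) * (P u * Real.cos (j * u)) +
          -(Q t * Real.sin (j * t)) * (P u * Real.sin (j * u)) := by
      intro u
      rw [mul_add, Real.cos_add]
      ring
    simp_rw [e]
    rw [intervalIntegral.integral_add (by apply Continuous.intervalIntegrable; fun_prop)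
      (by apply Continuous.intervalIntegrable; fun_prop), intervalIntegral.integral_const_mul,
      intervalIntegral.integral_const_mul,
      integral_eq_zero_of_odd (u := fun u => P u * Real.sin (j * u)) (fun u => by
        simp only [hPeven, mul_neg, Real.sin_neg]),
      mul_zero, add_zero]
  simp_rw [h2]
  rw [intervalIntegral.integral_mul_const, mul_comm]

/-! ### The bridge: the coefficient recursion is the normalised Fourier transform of the orbit -/

/-- `fc F 0 = ∫ F > 0` for a positive continuous `F`. [folklore] -/
theorem fc_zero_pos {F : ℝ → ℝ} (hc : Continuous F) (hpos : ∀ x, 0 < F x) : 0 < fc F 0 := by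
  simp only [fc, Int.cast_zero, zero_mul, Real.cos_zero, mul_one]
  exact intervalIntegral.intervalIntegral_pos_of_pos_on (hc.intervalIntegrable _ _)
    (fun x _ => hpos x) (by linarith [pi_pos])

/-- One `ℤ`-convolution of normalised coefficients against the coefficients of a multiple of
another function: `Σ_k (fc F k / Z) (C fc u (j-k)) = (2πC/Z) fc (u F) j`. [folklore] -/
theorem conv_fc_eq {F F' F'' u : ℝ → ℝ} (hF : NiceFun F F' F'') (hu : Continuous u) (Z C : ℝ)
    (j : ℤ) :
    conv (fun i => fc F i / Z) (fun i => C * fc u i) j =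
      2 * π * C / Z * fc (fun x => u x * F x) j := by
  have hsum := summable_abs_fc hF.periodic hF.hasDerivAt hF.hasDerivAt' hF.continuous''
  have h := (hasSum_fc_mul_fc hu hF.continuous hF.periodic hF.even hsum j).tsum_eq
  simp only [conv]
  have e : ∀ k : ℤ, fc F k / Z * (C * fc u (j - k)) = C / Z * (fc F k * fc u (j - k)) := by
    intro k; ring
  simp_rw [e]
  rw [tsum_mul_left, h]
  ring

/-- **The bridge.** The `n`-th Migdal–Kadanoff iterate of the normalised Fourier coefficients of
the `U(1)` Wilson weight is the normalised Fourier cosine transform of the `n`-th function-space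
iterate `mkFun β n`. [folklore] -/
theorem mkIter_u1WilsonCoeff_eq {β : ℝ} (hβ : 0 < β) :
    ∀ (n : ℕ) (j : ℤ), mkIter (u1WilsonCoeff β) n j = fc (mkFun β n) j / fc (mkFun β n) 0
  | 0, j => by
    simp only [mkIter, Function.iterate_zero, id_eq, u1WilsonCoeff, mkFun, fc, Int.cast_zero,
      zero_mul, Real.cos_zero, mul_one]
    have hper1 : Periodic (fun θ => Real.exp (β * Real.cos θ) * Real.cos (j * θ)) (2 * π) :=
      fun θ => by
        show Real.exp (β * Real.cos (θ + 2 * π)) * Real.cos (j * (θ + 2 * π)) =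
          Real.exp (β * Real.cos θ) * Real.cos (j * θ)
        rw [Real.cos_add_two_pi, mul_add, Real.cos_add_int_mul_two_pi]
    have hper0 : Periodic (fun θ => Real.exp (β * Real.cos θ)) (2 * π) := fun θ => by
      show Real.exp (β * Real.cos (θ + 2 * π)) = Real.exp (β * Real.cos θ)
      rw [Real.cos_add_two_pi]
    have h1 := hper1.intervalIntegral_add_eq 0 (-π)
    have h0 := hper0.intervalIntegral_add_eq 0 (-π)
    rw [zero_add, neg_pi_add_two_pi] at h1 h0
    rw [h1, h0]
  | n + 1, j => by
    obtain ⟨F', F'', hF, -⟩ := mkFun_spec hβ.le n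
    set F := mkFun β n with hFdef
    have ih : mkIter (u1WilsonCoeff β) n = fun i => fc F i / fc F 0 :=
      funext fun i => mkIter_u1WilsonCoeff_eq hβ n i
    have hZ : 0 < fc F 0 := fc_zero_pos hF.continuous hF.pos
    rw [mkIter, Function.iterate_succ_apply', ← mkIter, ih]
    -- the three convolutions
    have c1 : conv (fun i => fc F i / fc F 0) (fun i => fc F i / fc F 0) =
        fun i => 2 * π * (1 / fc F 0) / fc F 0 * fc (fun x => F x * F x) i := by
      funext i
      have := conv_fc_eq hF hF.continuous (fc F 0) (1 / fc F 0) i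
      rw [← this]
      congr 1
      funext k
      ring
    have c2 : conv (fun i => fc F i / fc F 0)
        (fun i => 2 * π * (1 / fc F 0) / fc F 0 * fc (fun x => F x * F x) i) =
        fun i => 2 * π * (2 * π * (1 / fc F 0) / fc F 0) / fc F 0 *
          fc (fun x => F x * F x * F x) i := by
      funext i
      exact conv_fc_eq hF (by have := hF.continuous; fun_prop) (fc F 0) _ i
    have c3 : conv (fun i => fc F i / fc F 0)
        (fun i => 2 * π * (2 * π * (1 / fc F 0) / fc F 0) / fc F 0 *
          fc (fun x => F x * F x * F x) i) =
        fun i => 2 * π * (2 * π * (2 * π * (1 / fc F 0) / fc F 0) / fc F 0) / fc F 0 *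
          fc (fun x => F x * F x * F x * F x) i := by
      funext i
      exact conv_fc_eq hF (by have := hF.continuous; fun_prop) (fc F 0) _ i
    have hH4 : (fun x => F x * F x * F x * F x) = fun x => F x ^ 4 := by
      funext x; ring
    have hfpc : fourthPowerCoeff (fun i => fc F i / fc F 0) =
        fun i => 2 * π * (2 * π * (2 * π * (1 / fc F 0) / fc F 0) / fc F 0) / fc F 0 *
          fc (fun x => F x ^ 4) i := by
      rw [fourthPowerCoeff, c1, c2, c3, hH4]
    -- the function-space side
    have hH := hF.pow4
    have hK2 := hH.pconv hH
    have hK3 := hK2.pconv hH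
    have hHZ : 0 < fc (fun x => F x ^ 4) 0 := fc_zero_pos hH.continuous hH.pos
    have hstep : ∀ i, fc (mkFun β (n + 1)) i = fc (fun x => F x ^ 4) i ^ 4 := by
      intro i
      show fc (mkFunStep F) i = _
      rw [mkFunStep, fc_pconv hK3.continuous hH.continuous hK3.periodic hK3.even,
        fc_pconv hK2.continuous hH.continuous hK2.periodic hK2.even,
        fc_pconv hH.continuous hH.continuous hH.periodic hH.even]
      ring
    rw [hstep, hstep, mkStep, hfpc]
    have hc0 : 2 * π * (2 * π * (2 * π * (1 / fc F 0) / fc F 0) / fc F 0) / fc F 0 ≠ 0 := by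
      positivity
    rw [mul_div_mul_left _ _ hc0, div_pow]

/-- **The normalised coefficients are controlled by the curvature bound**:
`|fc F j / fc F 0| ≤ e^{Bπ²/2} - 1` when `b_F ≤ B`. [folklore] -/
theorem abs_fc_div_le {F F' F'' : ℝ → ℝ} (h : NiceFun F F' F'') {B : ℝ} (hB : 0 ≤ B)
    (hc : ∀ x, F' x ^ 2 - F'' x * F x ≤ B * F x ^ 2) {j : ℤ} (hj : j ≠ 0) :
    |fc F j / fc F 0| ≤ Real.exp (B * π ^ 2 / 2) - 1 := by
  obtain ⟨M, hM0, hMle, hMge⟩ := exists_bounds_of_curv h hB hc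
  have hZ : 0 < fc F 0 := fc_zero_pos h.continuous h.pos
  have hcF := h.continuous
  -- lower bound on the mean
  have hZge : 2 * π * (M * Real.exp (-(B * π ^ 2 / 2))) ≤ fc F 0 := by
    simp only [fc, Int.cast_zero, zero_mul, Real.cos_zero, mul_one]
    have := intervalIntegral.integral_mono_on (by linarith [pi_pos]) intervalIntegrable_const
      (hcF.intervalIntegrable _ _) (fun x _ => hMge x) (a := -π) (b := π) (μ := volume)
    rw [intervalIntegral.integral_const, smul_eq_mul] at this
    linarith
  -- `∫ cos(jθ) = 0` over a period
  -- (cf. `Literature.Probability.LatticeModels.integral_cos_int_mul_eq_zero`)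
  have hcos0 : ∫ θ in (-π)..π, Real.cos (j * θ) = 0 := by
    have hj' : (j : ℝ) ≠ 0 := Int.cast_ne_zero.2 hj
    rw [intervalIntegral.integral_comp_mul_left (fun θ => Real.cos θ) hj', integral_cos]
    simp [mul_neg, Real.sin_neg, Real.sin_int_mul_pi]
  -- upper bound on the oscillating coefficient
  have hnum : |fc F j| ≤ 2 * π * M - fc F 0 := by
    have e : fc F j = ∫ θ in (-π)..π, (F θ - M) * Real.cos (j * θ) := by
      rw [fc, ← sub_zero (∫ θ in (-π)..π, F θ * Real.cos (j * θ)),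
        ← mul_zero M, ← hcos0, ← intervalIntegral.integral_const_mul,
        ← intervalIntegral.integral_sub (by apply Continuous.intervalIntegrable; fun_prop)
          (by apply Continuous.intervalIntegrable; fun_prop)]
      exact intervalIntegral.integral_congr fun θ _ => by ring
    rw [e]
    calc |∫ θ in (-π)..π, (F θ - M) * Real.cos (j * θ)|
        ≤ ∫ θ in (-π)..π, |(F θ - M) * Real.cos (j * θ)| :=
          intervalIntegral.abs_integral_le_integral_abs (by linarith [pi_pos])
      _ ≤ ∫ θ in (-π)..π, (M - F θ) := by
          refine intervalIntegral.integral_mono_on (by linarith [pi_pos])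
            ((Continuous.abs (by fun_prop)).intervalIntegrable _ _)
            (Continuous.intervalIntegrable (by fun_prop) _ _) fun θ _ => ?_
          rw [abs_mul, abs_sub_comm, abs_of_nonneg (by linarith [hMle θ])]
          calc (M - F θ) * |Real.cos (j * θ)| ≤ (M - F θ) * 1 :=
                mul_le_mul_of_nonneg_left (Real.abs_cos_le_one _) (by linarith [hMle θ])
            _ = M - F θ := mul_one _
      _ = 2 * π * M - fc F 0 := by
          rw [intervalIntegral.integral_sub intervalIntegrable_const (hcF.intervalIntegrable _ _),
            intervalIntegral.integral_const, smul_eq_mul]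
          simp only [fc, Int.cast_zero, zero_mul, Real.cos_zero, mul_one]
          ring
  rw [abs_div, abs_of_pos hZ, div_le_iff₀ hZ]
  have hexp : Real.exp (-(B * π ^ 2 / 2)) * Real.exp (B * π ^ 2 / 2) = 1 := by
    rw [← Real.exp_add]; simp
  have h2M : 2 * π * M ≤ fc F 0 * Real.exp (B * π ^ 2 / 2) := by
    have := mul_le_mul_of_nonneg_right hZge (Real.exp_pos (B * π ^ 2 / 2)).le
    calc 2 * π * M = 2 * π * (M * Real.exp (-(B * π ^ 2 / 2))) * Real.exp (B * π ^ 2 / 2) := by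
          rw [mul_assoc (2 * π), mul_assoc M, hexp, mul_one]
      _ ≤ fc F 0 * Real.exp (B * π ^ 2 / 2) := this
  nlinarith

end Literature.Barriers.QuantumFields.MigdalKadanoff.Ito

namespace Literature.Barriers.QuantumFields.MigdalKadanoff

open Real MeasureTheory intervalIntegral Set Filter Function Ito in
/-- **Ito's theorem for compact QED₄ (discharge of `MigdalKadanoffGroupBlindness`).** For every
`β > 0` the standard `D = 4`, `b = 2` Migdal–Kadanoff iterates of the normalised Fourier
coefficients of the `U(1)` Wilson weight `exp(β cos θ)` converge coefficient-wise to the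
strong-coupling fixed point, `c_j(n) → 0` for `j ≠ 0`.

Proof (Ito's local-curvature Lyapunov argument, CMP 110 §3, in the `U(1)` case announced in
§5 there and proved in PRL 54 (1985) 2383): in function space the recursion is
`F ↦ ((F⁴ ⋆ F⁴) ⋆ F⁴) ⋆ F⁴`; the maximal local curvature `B_n = max (-(log F_n)″)` obeys
`B_{n+1} ≤ (1 - e^{-4π²B_n}/4) B_n` (`Ito.mkFunStep_spec`: Cauchy–Schwarz across the convolution
plus the zero mean of `(log F)″` over a period), hence `B_n → 0` (`Ito.tendsto_bseq`), hence
`e^{-B_nπ²/2} max F_n ≤ F_n ≤ max F_n` and `|c_j(n)| ≤ e^{B_nπ²/2} - 1 → 0`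
(`Ito.abs_fc_div_le`); the identification of the coefficient recursion with the function
recursion is `Ito.mkIter_u1WilsonCoeff_eq` (Fourier coefficients of products and periodic
convolutions). [cite: Ito1987HierarchicalHeisenberg, §3 and §5] -/
theorem _root_.Literature.Barriers.QuantumFields.MigdalKadanoffGroupBlindness_holds :
    MigdalKadanoffGroupBlindness := by
  intro β hβ j hj
  have heq : (fun n => mkIter (u1WilsonCoeff β) n j) =
      fun n => fc (mkFun β n) j / fc (mkFun β n) 0 :=
    funext fun n => mkIter_u1WilsonCoeff_eq hβ n j
  rw [heq]
  have hbd : ∀ n, ‖fc (mkFun β n) j / fc (mkFun β n) 0‖ ≤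
      Real.exp (bseq β n * π ^ 2 / 2) - 1 := fun n => by
    obtain ⟨F', F'', hF, hc⟩ := mkFun_spec hβ.le n
    rw [Real.norm_eq_abs]
    exact abs_fc_div_le hF (bseq_nonneg hβ.le n) hc hj
  have hlim : Tendsto (fun n => Real.exp (bseq β n * π ^ 2 / 2) - 1) atTop (nhds 0) := by
    have h1 : Tendsto (fun n => bseq β n * π ^ 2 / 2) atTop (nhds (0 * π ^ 2 / 2)) :=
      ((tendsto_bseq hβ.le).mul_const _).div_const _
    rw [zero_mul, zero_div] at h1
    have h2 := (Real.continuous_exp.tendsto 0).comp h1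
    rw [Real.exp_zero] at h2
    have h3 := h2.sub_const 1
    rw [sub_self] at h3
    exact h3
  exact squeeze_zero_norm hbd hlim

end Literature.Barriers.QuantumFields.MigdalKadanoff
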